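import Summits.AnomalousDissipation.AnomalousDissipation.Theorems.SolenoidalFractalHomogenisationLagrangianStepCellCorrectorContent
import Summits.AnomalousDissipation.AnomalousDissipation.Theorems.SolenoidalFractalHomogenisationLagrangianStepCellClauseCutsW
import Summits.AnomalousDissipation.AnomalousDissipation.Theorems.SolenoidalFractalHomogenisationLagrangianStepCarrierFastContent
import Summits.AnomalousDissipation.AnomalousDissipation.Theorems.SolenoidalFractalHomogenisationLagrangianStepMeanConservation
import Literature.Analysis.FluidPDE.PassiveVectorTensorWeakContinuity
import Literature.Analysis.FluidPDE.PassiveVectorTensorDuality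
import Literature.Analysis.FluidPDE.PassiveVectorTensorLionsExistence
import Literature.Analysis.FunctionSpaces.TimeMollification
import HarnessLib

/-!
# K1L `LagrangianRenormalisationStep` (stmt-AnomalousDissipation-24912), line `onelevel`, stub `stub_cellEnergyT`:
# the UNIFORM slow-leakage clause (F) by DUALITY with the adjoint cell problem (finding F-p4g10-1, lens «control»)

Crux workfile (planner `ad-ideate-p4` g10; sketches + candidate texts; NOT a Theorems file, NOT the stub, says nothing about anomalous
dissipation).  Zero `sorry`: every `theorem` below is proved; the candidate texts are `def … : Prop`.

## The claim

The v21 registered stub `stub_cellEnergyT` (conclusion `CellEnergyClausesNoE W M hM c lo hi Λ β C ν₀ K`, clauses (F) ∧ (C)) is provable AS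
TYPED, with `C = 36k²Λ²/(π⁴lo²c)`, `ν₀ = 1`, `K = 2` (any `0 < 2ν₀ ≤ K` works), i.e. the slow leakage (F) holds UNIFORMLY IN `T`:

  `lowEnergy L (u t) ≤ (36k²Λ²/(π⁴lo²c)) · (cL²/(n²ν²)) · ∫‖F‖²`  for a.e. `t ∈ (0,T)`, every `T`,

so the window-local re-cut (F_T) (`CellEnergyClausesWNoE`, tenure D24-4 after finding F-lead-1) is not needed for `stub_cellEnergyT`, and
`stub_oneLevelL` may keep the uniform hypothesis `CellEnergyClauses`.

## Why the forward estimate fails and the dual one does not (the «control» lever)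

F-lead-1 is right that no FLUX-MAGNITUDE energy method gives (F) uniformly: the slow/fast block system `x' = ηy, y' = −ηx − λy` started from
FAST data `(0,1)` really has `sup_t x(t) ≈ η/λ = O(1)·(coupling/gap)` only after discarding the sign of the skew coupling; keeping it, the exact
solution has `sup x = η/(μ₊−μ₋) ≈ η/λ`… but (F) asks for the ENERGY `x²`, and for the true skew system `x(t) = η∫₀ᵗ y`, `|y| ≤ e^{−λs}`-ish is
NOT available forward because `x` feeds back into `y`.  The dual problem removes the feedback bookkeeping: to bound the slow coefficient
`⟨u(t₀), φ⟩` (`φ = Re e_ℓ·p` or `Im e_ℓ·p`, a SLOW single mode) one solves the ADJOINT cell problem BACKWARDS from the slow datum `φ`,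
`ψ` = weak solution on `(0,t₀)` of the same class with tensor `majorTranspose ((1/n²)•𝔸)` and carrier `revCarrier b t₀ = (r,x) ↦ −b(t₀−r,x)`,
and uses the (formal, see D1) pairing identity `⟨u(t₀), φ⟩ = ⟨F, ψ(t₀)⟩`.  Now `F` is FLUCTUATION data (no modes below `n/2`), so only the
FAST CONTENT of `ψ` is seen: `|⟨F, ψ(r)⟩| ≤ ‖P_{Σ(ℓ)}F‖ · ‖(1 − P_{±ℓ})ψ(r)‖`, and the fast content of a solution started from SLOW
data is exactly what clause (C) controls UNIFORMLY IN TIME (landed `cell_corrector_content`, p634914: FastBlock `ae_complement_energy_le`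
with `S = {±ℓ}`, gap `ρ = n²/4`, forcing `Γ² = 4π²|ℓ|²‖φ‖²` sourced by the energy-bounded slow part — plain damping, no growing mode).  The
adjoint problem is in the SAME CLASS: `NearIso`/`OddSmall` are invariant under `majorTranspose` (`nearIso_majorTranspose_iff`,
`OddSmall.majorTranspose`), and `revCarrier (cellField …) t₀` has the three properties the proof of `cell_corrector_content` uses
(`‖·‖ ≤ k/(2πn)`, invariance under the `n`-torsion grid, joint continuity ⇒ `L^∞`) — §1 below proves them.

Toy check (2×2, exact): adjoint from slow datum `(1,0)`: `X' = −ηY, Y' = ηX − λY`, `X(0)=1, Y(0)=0` ⇒ `sup|Y| ≤ η/λ` and `X² + Y² ≤ 1`: the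
fast content of the adjoint is `≤ (η/λ)²` uniformly, which is (C); pairing with fast data `F = (0,f)` gives `|x(t₀)| = |f·Y(t₀)| ≤ (η/λ)|f|`,
i.e. `x² ≤ (η/λ)² f²` uniformly in `t₀` — the uniform (F) with the (C) constant, while the forward comparison system only gave `e^{4η²t/λ}`.

## Constants

Per slow mode `ℓ ≠ 0`, `‖ℓ‖ ≤ L ≤ n/3` (from `L⌈K/ν⌉₊ ≤ n`, `ν < ν₀ ≤ K/2`), unit `p ⊥ ℓ`, `φ ∈ {Re e_ℓ·p, Im e_ℓ·p}` (`‖φ‖² = 1/2`,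
weakly div-free, `H¹`): `D(φ) := sup_r ‖(1−P_{±ℓ})ψ(r)‖² ≤ 9k²λ²|ℓ|²‖φ‖²/(π⁴n²ν²lo²)` (the (C) computation with `lo' = νlo/(λn²)`,
`M = k/(2πn)`); `⟨u t₀, Re e_ℓ p⟩² + ⟨u t₀, Im e_ℓ p⟩² = |p·û(t₀)(ℓ)|² ≤ 2·‖P_{Σ(ℓ)}F‖²·D = 9k²λ²|ℓ|²‖P_{Σ(ℓ)}F‖²/(π⁴n²ν²lo²)`;
summing the two transverse polarisations (`ℓ·û(ℓ) = 0` by weak div-freeness a.e.) `sectorEnergy ℓ (u t₀) ≤ 18k²λ²|ℓ|²‖P_{Σ(ℓ)}F‖²/(π⁴n²ν²lo²)`;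
the pair-sectors `Σ(ℓ) = {±ℓ} + nℤ³` of distinct pairs `{±ℓ} ≠ {±ℓ'}` with `‖ℓ‖,‖ℓ'‖ ≤ L < n/2` are DISJOINT and `Σ(ℓ) = Σ(−ℓ)`, so
`Σ_{0<‖ℓ‖≤L} ‖P_{Σ(ℓ)}F‖² ≤ 2‖F‖²`; mode `0`: `û(t)(0) = F̂(0) = 0` (mean conservation, test `Ψ = θ(t)e`).  Total:
`lowEnergy L (u t₀) ≤ 36k²λ²L²‖F‖²/(π⁴n²ν²lo²) ≤ (36k²Λ²/(π⁴lo²c))·(cL²/(n²ν²))·∫‖F‖²`.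

## Lemma chain (what this file types / proves)

* §1 (PROVED): `revCarrier`; sup bound, grid invariance, joint continuity, `L^∞` lift of `revCarrier (cellField …) t₀`; a.e. weak
  div-freeness by reflection; `exists_adjoint` (Lions existence p… `exists_isWeakTensorPassiveVectorOn` for the adjoint cell problem).
* §2 the duality package over the tensor class (Props; sizes): D1 `PairingConst` (L, the ONE new Literature lemma: the pairing
  `s ↦ ⟨u(s), ψ(t₀−s)⟩` is a.e. constant on `(0,t₀)` — MODE-WISE proof: by `ae_inner_mFourierCoeff_eq` each `X_k(s) = û(s)(k)`,
  `Y_k(r) = ψ̂(r)(k)` is absolutely continuous with `X_k' = −T_𝔹(k)X_k + A_k(s)`, `Y_k' = −T_{𝔹ᵀ}(k)Y_k + B_k(r)` where `T_{𝔹ᵀ}(k) = T_𝔹(k)ᵀ`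
  (real matrices, `symb_majorTranspose`), so `d/ds Σ_{|k|≤N} X_k(s)·conj Y_k(t₀−s)` has NO viscous term and its advective part is
  `∫⟪(b·∇)P_N u, ψ̃⟫ + ⟪u, (b·∇)P_N ψ̃⟫`-type, which → 0 in `L¹(0,t₀)` as `N → ∞` by antisymmetry of `(b·∇)` (b div-free, `L^∞`) and
  `u, ψ ∈ L²H¹` (`ae_energy_ineq` gives `2·eVectorDissipation ≤ energy`); no admissibility of `ψ` as a test function is needed);
  D2 `InitialTrace` (M: strong `L²` right-continuity at `0⁺`, from the energy inequality `limsup ‖w(s)‖² ≤ ‖w₀‖²` plus weak continuity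
  `⟨w(s), Φ⟩ → ⟨w₀, Φ⟩` for smooth div-free `Φ` (weak form with tests `θ_ε(t)Φ`) and for gradients (both sides vanish), density);
  D3 `ContinuousRepr` (M: `t ↦ ⟨w(t), φ⟩` has a continuous representative — the weak form with tests `θ(t)·(P_N φ)` gives
  `W^{1,1}` in time mode-wise, and the tail `‖(1−P_N)φ‖·sup‖w‖` is uniformly small);
  `DualityBound` — PROVED here from D1–D3 (`dualityBound_of`): for a.e. `t₀`, every adjoint solution `ψ` from `φ` and every a.e. bound
  `|⟨F, ψ(r)⟩| ≤ B` on `(0,t₀)` give `|⟨u(t₀), φ⟩| ≤ B`.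
* §3 candidate texts for the line (Props): `CarrierFastContent` (S: `cell_corrector_content`'s proof verbatim for a general carrier with the
  three properties and a general `{±ℓ}`-supported `L²` div-free datum; conclusion = uniform fast-content bound `D`); `UniformSlowLeak`
  (= clause (F) with the explicit constant; M given `DualityBound` + `CarrierFastContent` + `exists_adjoint` + the Parseval/sector count
  above); and the PROVED glue `cellEnergyT_of_uniformSlowLeak : UniformSlowLeak → <v21 stub_cellEnergyT statement verbatim>` (clause (C)
  from `cell_corrector_content`, constant enlarged `9 ≤ 36`).

* §4 (v2): typed split `UniformSlowLeak ⇐ SlowModeBound (M) + SectorCount (S) + MeanConservation (S)` with the PROVED assembly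
  `uniformSlowLeak_of` (constants close exactly on the stub's text).
  v3: `sectorCount : SectorCount` (Parseval + a pointwise count: each frequency lies in ≤ 2 slow pair-sectors) and
  `meanConservation : MeanConservation` (modewise identity at `k = 0`) are PROVED here, so §5 gives the net chain
  `cellEnergyT_of_slowModeBound : SlowModeBound → <v21 stub_cellEnergyT statement verbatim>`.
* §6 (v4): `slowModeBound_of : PairingConst → InitialTrace → ContinuousRepr → CarrierFastContent → SlowModeBound` is PROVED here
  (transversal single-mode tests `Re(e_ℓ • q_jℂ)`, `Re(e_ℓ • I q_jℂ)` with `q_j = e_j − (ℓ_j/|ℓ|²)ℓ`, `Σ_j ‖q_j‖² = 2`; Lions adjoint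
  solution; sector support + fast content of the adjoint; Parseval pairing with a Young parameter `α` and `x² ≤ PD` from
  `∀ α, |x| ≤ αP/2 + D/(2α)`; exact `∫‖Re(e_ℓ • z)‖² = ‖z‖²/2`; transversality of `û(t₀)(ℓ)` from a.e. weak div-freeness), whence the
  net theorem `cellEnergyT_of_D123_CF : PairingConst → InitialTrace → ContinuousRepr → CarrierFastContent → <v21 stub text verbatim>`.

* §7 (v5): D2 `InitialTrace`, D3 in the div-free-test shape `ContinuousReprDF`, `CarrierFastContent` (and `MeanConservation`) are
  discharged BY NAME from the tree — `forall_eps_ae_integral_norm_sq_sub_le_of_nearIso`, `exists_continuousOn_integral_inner`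
  (ad-lit g25, p638640 `PassiveVectorTensorWeakContinuity.lean`), `ae_complement_pair_energy_le` (p639358), `ae_modeCoeff_zero_eq`
  (p638532) — and the assembly is re-run through `ContinuousReprDF` (`dualityBound_core`), whence
  **`cellEnergyT_of_D1 : PairingConst → <v21 stub_cellEnergyT text verbatim>`**.

* §8 (v6): `cellEnergyClausesWNoE_of_noE` ((F) ⇒ (F_T), `exp ≥ 1`) and `cellEnergyT_W_of_D1 : PairingConst → <K1L_D registry-v2 text of
  stub_cellEnergyT (conclusion CellEnergyClausesWNoE)>` — the duality line also closes the RE-TYPED stub (tenure D24-5), from D1 alone.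

* §9 (v7): D1 LANDED (ad-lit g25, p640160 `PassiveVectorTensorDuality.lean`): `pairingConst : PairingConst` (adapter, `funext`), hence
  `cellEnergyT_uniform : <v21 text>` and `cellEnergyT_windowLocal : <registry-v2 text>` with NO hypotheses — the duality line is COMPLETE
  (axioms propext / Classical.choice / Quot.sound).  Landable twin: `CellEnergyTPort.lean` (same directory).

So (v5) the v21 stub reduces BY NAME to ONE input (and since v7 that input is a theorem): D1 `PairingConst` (L, ad-lit g25's next file `PassiveVectorTensorDuality.lean`); then
`cellEnergyT_of_D1 hD1` closes `stub_cellEnergyT` (port = this file with the `Cruxes` namespace swapped for the Theorems one and the §4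
duplicates `slowBox … sum_indicator_pairSector_le` replaced by the landed `…LagrangianStepSectorCount` decls of the same names).
Barriers: none of the catalogued AnomalousDissipation barriers concerns linear passive-vector cell problems; the F-lead-1 obstruction
(growing mode of the forward comparison system) is evaded because no comparison system is used — the sign structure is kept exactly by duality.
-/

set_option linter.dupNamespace false

noncomputable section

namespace Summit.AnomalousDissipation.AnomalousDissipation.Cruxes.LagrangianRenormalisationStep.DualLeakage

open Literature.Analysis Literature.Analysis.FluidPDE Literature.Analysis.FunctionSpaces
open Literature.Analysis.FluidPDE.LatticeShear
open MeasureTheory Set Filter Function UnitAddTorus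
open scoped ENNReal NNReal InnerProductSpace Topology
open Summit.AnomalousDissipation.AnomalousDissipation.Theorems.SolenoidalFractalHomogenisation.LagrangianStep
open Summit.AnomalousDissipation.AnomalousDissipation.Theorems.SolenoidalFractalHomogenisation.RealisedQuasiStaticCellLaw

/-! ## §1 The reversed carrier of the adjoint problem -/

/-- The carrier of the adjoint (backward) problem based at time `t₀`: `(r, x) ↦ −b(t₀ − r, x)`. -/
def revCarrier (b : ℝ → VF) (t₀ : ℝ) : ℝ → VF := fun r x => -(b (t₀ - r) x)

@[simp] theorem revCarrier_apply (b : ℝ → VF) (t₀ r : ℝ) (x : UnitAddTorus (Fin 3)) :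
    revCarrier b t₀ r x = -(b (t₀ - r) x) := rfl

/-- Sup bound WITH the `1/n`: `‖revCarrier (cellField …) t₀ r x‖ ≤ k/(2πn)` (`norm_cell_le_div`). [folklore] -/
theorem norm_revCarrier_cellField_le {k : ℕ} (W : LatticeWord k) (M : ℝ) (hM : 0 < M) {ν : ℝ} (hν : 0 < ν) {n : ℕ}
    (hn : 0 < n) (t₀ r : ℝ) (x : UnitAddTorus (Fin 3)) :
    ‖revCarrier (cellField W M hM ν hν n) t₀ r x‖ ≤ k / (2 * Real.pi * n) := by
  rw [revCarrier_apply, norm_neg]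
  exact norm_cell_le_div _ hn _ x

/-- Crude sup bound `‖revCarrier (cellField …) t₀ r x‖ ≤ k/(2π)` (`norm_cell_le`, any `n`). [folklore] -/
theorem norm_revCarrier_cellField_le' {k : ℕ} (W : LatticeWord k) (M : ℝ) (hM : 0 < M) {ν : ℝ} (hν : 0 < ν) (n : ℕ)
    (t₀ r : ℝ) (x : UnitAddTorus (Fin 3)) :
    ‖revCarrier (cellField W M hM ν hν n) t₀ r x‖ ≤ k / (2 * Real.pi) := by
  rw [revCarrier_apply, norm_neg]
  exact norm_cell_le _ n _ x

/-- The reversed cell carrier is invariant under the `n`-torsion grid translations (`cell_add_grid`). [folklore] -/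
theorem revCarrier_cellField_add_grid {k : ℕ} (W : LatticeWord k) (M : ℝ) (hM : 0 < M) {ν : ℝ} (hν : 0 < ν) {n : ℕ}
    (hn : 0 < n) (j : Fin 3 → Fin n) (t₀ r : ℝ) (x : UnitAddTorus (Fin 3)) :
    revCarrier (cellField W M hM ν hν n) t₀ r (x + fun i => ((((j i : ℕ) : ℝ) / n : ℝ) : UnitAddCircle)) =
      revCarrier (cellField W M hM ν hν n) t₀ r x := by
  simp only [revCarrier_apply, cellField, cell_add_grid _ hn]

/-- The reversed cell carrier is jointly continuous on `ℝ × T³` (`continuous_uncurry_cell`). [folklore] -/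
theorem continuous_uncurry_revCarrier_cellField {k : ℕ} (W : LatticeWord k) (M : ℝ) (hM : 0 < M) {ν : ℝ} (hν : 0 < ν)
    (n : ℕ) (t₀ : ℝ) : Continuous (uncurry (revCarrier (cellField W M hM ν hν n) t₀)) := by
  have e : uncurry (revCarrier (cellField W M hM ν hν n) t₀) =
      fun p : ℝ × UnitAddTorus (Fin 3) => -(uncurry (cellField W M hM ν hν n) (t₀ - p.1, p.2)) := by
    funext ⟨r, x⟩
    rfl
  rw [e]
  exact ((continuous_uncurry_cell _ n).comp ((continuous_const.sub continuous_fst).prodMk continuous_snd)).neg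

/-- The space–time lift of the reversed cell carrier is in `L^∞((0,T') × T³)`. [folklore] -/
theorem memLp_top_stLift_revCarrier_cellField {k : ℕ} (W : LatticeWord k) (M : ℝ) (hM : 0 < M) {ν : ℝ} (hν : 0 < ν)
    (n : ℕ) (t₀ T' : ℝ) :
    MemLp (FunctionSpaces.Torus.stLift (revCarrier (cellField W M hM ν hν n) t₀)) ∞
      (volume.restrict (Ioo 0 T' ×ˢ (univ : Set (EuclideanSpace ℝ (Fin 3))))) := by
  have hc : Continuous (FunctionSpaces.Torus.stLift (revCarrier (cellField W M hM ν hν n) t₀)) := by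
    have e : FunctionSpaces.Torus.stLift (revCarrier (cellField W M hM ν hν n) t₀) =
        uncurry (revCarrier (cellField W M hM ν hν n) t₀) ∘ Prod.map id FunctionSpaces.Torus.proj := by
      funext ⟨t, y⟩
      rfl
    rw [e]
    exact (continuous_uncurry_revCarrier_cellField W M hM hν n t₀).comp
      (continuous_id.prodMap FunctionSpaces.Torus.continuous_proj)
  exact memLp_top_of_bound hc.aestronglyMeasurable (k / (2 * Real.pi))
    (ae_of_all _ fun p => norm_revCarrier_cellField_le' W M hM hν n t₀ p.1 (FunctionSpaces.Torus.proj p.2))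

/-- Reflection `r ↦ t₀ − r` of an a.e. statement on `(0,t₀)`. [folklore] -/
theorem ae_restrict_Ioo_reflect {t₀ : ℝ} {P : ℝ → Prop} (h : ∀ᵐ r ∂(volume.restrict (Ioo 0 t₀)), P r) :
    ∀ᵐ s ∂(volume.restrict (Ioo 0 t₀)), P (t₀ - s) := by
  rw [ae_restrict_iff' measurableSet_Ioo] at h ⊢
  have h' := (Measure.measurePreserving_sub_left volume t₀).quasiMeasurePreserving.ae h
  filter_upwards [h'] with s hs hsI
  exact hs ⟨by linarith [hsI.2], by linarith [hsI.1]⟩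

/-- A property holding a.e. on a nondegenerate interval holds somewhere in it. [folklore] -/
theorem exists_of_ae_Ioo {a c : ℝ} (hac : a < c) {P : ℝ → Prop} (h : ∀ᵐ s ∂(volume.restrict (Ioo a c)), P s) :
    ∃ s ∈ Ioo a c, P s := by
  have hne : NeBot (ae (volume.restrict (Ioo a c))) := by
    rw [ae_neBot, Ne, Measure.restrict_eq_zero, Real.volume_Ioo, ENNReal.ofReal_eq_zero, not_le, sub_pos]
    exact hac
  obtain ⟨s, hs⟩ := (h.and (ae_restrict_mem measurableSet_Ioo)).exists
  exact ⟨s, hs.2, hs.1⟩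

/-- The reversed cell carrier is weakly divergence free for a.e. `r ∈ (0,t₀)` whenever a weak solution on `(0,T) ⊇ (0,t₀)` exists (the
class records `∇·b(t) = 0` a.e.). [folklore] -/
theorem ae_isWeaklyDivFree_revCarrier {b : ℝ → VF} {T t₀ : ℝ} (ht₀ : t₀ ≤ T) {𝔹 : Torus.Visc4 (Fin 3)} {F : VF} {u : ℝ → VF}
    (hu : Torus.IsWeakTensorPassiveVectorOn 0 T 𝔹 b F u) :
    ∀ᵐ r ∂(volume.restrict (Ioo 0 t₀)), FunctionSpaces.Torus.IsWeaklyDivFree (revCarrier b t₀ r) := by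
  have h1 := ae_restrict_Ioo_reflect
    (ae_restrict_of_ae_restrict_of_subset (Ioo_subset_Ioo_right ht₀) hu.ae_isWeaklyDivFree_carrier)
  filter_upwards [h1] with r hr
  intro θ hθ
  have h0 := hr θ hθ
  simp only [revCarrier_apply, inner_neg_left, integral_neg, neg_eq_zero]
  exact h0

/-- **Existence of the adjoint.** For every weak cell solution `u` on `(0,T)` (tensor `(1/n²)•𝔸` in the `ν`-scaled window, carrier
`cellField`), every `t₀ ∈ (0,T]` and every `L²` weakly div-free datum `φ`, the ADJOINT cell problem — tensor `majorTranspose ((1/n²)•𝔸)`,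
carrier `revCarrier (cellField …) t₀` — has a weak solution on `(0,t₀)` (Lions, `exists_isWeakTensorPassiveVectorOn`; the transposed tensor
is in the same window by `nearIso_majorTranspose_iff`). [cite: Evans2010, §7.1.2 Thm. 3] -/
theorem exists_adjoint {k : ℕ} (W : LatticeWord k) (M : ℝ) (hM : 0 < M) {lo hi lam ν : ℝ} (hlo : 0 < lo) (hlam : 0 < lam)
    (hν : 0 < ν) {n : ℕ} (hn : 0 < n) {𝔸 : Torus.Visc4 (Fin 3)} (hA : Torus.NearIso 𝔸 (ν * (lo / lam)) (ν * (hi * lam)))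
    {T : ℝ} {F : VF} {u : ℝ → VF}
    (hu : Torus.IsWeakTensorPassiveVectorOn 0 T ((1 / (n:ℝ) ^ 2) • 𝔸) (cellField W M hM ν hν n) F u)
    {t₀ : ℝ} (ht₀ : t₀ ∈ Ioc 0 T) {φ : VF} (hφ2 : MemLp φ 2 volume) (hφdiv : FunctionSpaces.Torus.IsWeaklyDivFree φ) :
    ∃ ψ : ℝ → VF, Torus.IsWeakTensorPassiveVectorOn 0 t₀ (Torus.majorTranspose ((1 / (n:ℝ) ^ 2) • 𝔸))
      (revCarrier (cellField W M hM ν hν n) t₀) φ ψ := by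
  have hn' : (0:ℝ) < n := by exact_mod_cast hn
  have hN : Torus.NearIso ((1 / (n:ℝ) ^ 2) • 𝔸) ((1 / (n:ℝ) ^ 2) * (ν * (lo / lam))) ((1 / (n:ℝ) ^ 2) * (ν * (hi * lam))) :=
    hA.smul (by positivity)
  have hN' := (Torus.nearIso_majorTranspose_iff _ _ _).2 hN
  have hlo' : 0 < (1 / (n:ℝ) ^ 2) * (ν * (lo / lam)) := by positivity
  exact Torus.exists_isWeakTensorPassiveVectorOn ht₀.1 hN' hlo' (memLp_top_stLift_revCarrier_cellField W M hM hν n t₀ t₀)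
    (ae_isWeaklyDivFree_revCarrier ht₀.2 hu) hφ2 hφdiv

/-! ## §2 The duality package (D1–D3 candidate Literature texts; `DualityBound` proved from them) -/

/-- `L²` pairings of slices are integrable. [folklore] -/
theorem integrable_inner₂ {f g : VF} (hf : MemLp f 2 volume) (hg : MemLp g 2 volume) :
    Integrable (fun x => ⟪f x, g x⟫_ℝ) volume :=
  FunctionSpaces.integrable_inner_of_eLpNorm_two_lt_top hf.1 hg.1 hf.2 hg.2

/-- Young's inequality for the `L²(T³)` pairing. [folklore] -/
theorem abs_integral_inner_le_young {f g : VF} (hf : MemLp f 2 volume) (hg : MemLp g 2 volume) {η : ℝ} (hη : 0 < η) :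
    |∫ x, ⟪f x, g x⟫_ℝ| ≤ (∫ x, ‖f x‖ ^ 2) / (2 * η) + η / 2 * ∫ x, ‖g x‖ ^ 2 := by
  have hfi : Integrable (fun x => ‖f x‖ ^ 2) volume := hf.integrable_norm_pow two_ne_zero
  have hgi : Integrable (fun x => ‖g x‖ ^ 2) volume := hg.integrable_norm_pow two_ne_zero
  have hpt : ∀ x, |⟪f x, g x⟫_ℝ| ≤ ‖f x‖ ^ 2 / (2 * η) + η / 2 * ‖g x‖ ^ 2 := by
    intro x
    refine (abs_real_inner_le_norm (f x) (g x)).trans ?_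
    have key : 2 * η * (‖f x‖ * ‖g x‖) ≤ ‖f x‖ ^ 2 + η ^ 2 * ‖g x‖ ^ 2 := by
      nlinarith [sq_nonneg (‖f x‖ - η * ‖g x‖)]
    have e : ‖f x‖ ^ 2 / (2 * η) + η / 2 * ‖g x‖ ^ 2 = (‖f x‖ ^ 2 + η ^ 2 * ‖g x‖ ^ 2) / (2 * η) := by
      field_simp
    rw [e, le_div_iff₀ (by positivity)]
    linarith
  calc |∫ x, ⟪f x, g x⟫_ℝ| ≤ ∫ x, |⟪f x, g x⟫_ℝ| := abs_integral_le_integral_abs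
    _ ≤ ∫ x, (‖f x‖ ^ 2 / (2 * η) + η / 2 * ‖g x‖ ^ 2) :=
        integral_mono_of_nonneg (ae_of_all _ fun x => abs_nonneg _) ((hfi.div_const _).add (hgi.const_mul _))
          (ae_of_all _ hpt)
    _ = (∫ x, ‖f x‖ ^ 2) / (2 * η) + η / 2 * ∫ x, ‖g x‖ ^ 2 := by
        rw [integral_add (hfi.div_const _) (hgi.const_mul _), integral_div, integral_const_mul]

/-- Smallness form of Young: `‖f‖² ≤ κ²/(E+1)` and `‖g‖² ≤ E` give `|⟨f, g⟩| ≤ κ`. [folklore] -/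
theorem abs_integral_inner_le_of_small {f g : VF} (hf : MemLp f 2 volume) (hg : MemLp g 2 volume) {κ E : ℝ}
    (hκ : 0 < κ) (hE : 0 ≤ E) (hfε : ∫ x, ‖f x‖ ^ 2 ≤ κ * (κ / (E + 1))) (hgE : ∫ x, ‖g x‖ ^ 2 ≤ E) :
    |∫ x, ⟪f x, g x⟫_ℝ| ≤ κ := by
  have hη : 0 < κ / (E + 1) := by positivity
  have h := abs_integral_inner_le_young hf hg hη
  have h1 : (∫ x, ‖f x‖ ^ 2) / (2 * (κ / (E + 1))) ≤ κ / 2 := by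
    rw [div_le_iff₀ (by positivity)]
    calc ∫ x, ‖f x‖ ^ 2 ≤ κ * (κ / (E + 1)) := hfε
      _ = κ / 2 * (2 * (κ / (E + 1))) := by ring
  have h2 : κ / (E + 1) / 2 * ∫ x, ‖g x‖ ^ 2 ≤ κ / 2 := by
    calc κ / (E + 1) / 2 * ∫ x, ‖g x‖ ^ 2 ≤ κ / (E + 1) / 2 * E := mul_le_mul_of_nonneg_left hgE (by positivity)
      _ = κ / 2 * (E / (E + 1)) := by ring
      _ ≤ κ / 2 * 1 := mul_le_mul_of_nonneg_left ((div_le_one (by positivity)).2 (by linarith)) (by positivity)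
      _ = κ / 2 := mul_one _
  linarith

/-- **D1 (candidate Literature lemma, size L) — the duality pairing is constant.**  For a weak solution `u` of the tensor passive-vector
problem on `(0,T)` (tensor `𝔹` in an elliptic window, `L^∞` carrier `b`, `L²` weakly div-free datum `F`) and a weak solution `ψ` on `(0,t₀)`,
`t₀ ≤ T`, of the ADJOINT problem (tensor `majorTranspose 𝔹`, carrier `revCarrier b t₀`, `L²` weakly div-free datum `φ`), the pairing
`s ↦ ∫⟪u s, ψ (t₀ − s)⟫` is a.e. constant on `(0,t₀)`.  Proof route (mode-wise, no admissibility of `ψ` as a test): see the file docstring.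
[cite: Evans2010, §7.1.2-7.1.3] -/
def PairingConst : Prop :=
  ∀ (T : ℝ) (𝔹 : Torus.Visc4 (Fin 3)) (lo hi : ℝ), Torus.NearIso 𝔹 lo hi → 0 < lo →
  ∀ (b : ℝ → VF), MemLp (FunctionSpaces.Torus.stLift b) ∞ (volume.restrict (Ioo 0 T ×ˢ (univ : Set (EuclideanSpace ℝ (Fin 3))))) →
  ∀ (F : VF) (u : ℝ → VF), MemLp F 2 volume → FunctionSpaces.Torus.IsWeaklyDivFree F →
    Torus.IsWeakTensorPassiveVectorOn 0 T 𝔹 b F u →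
  ∀ t₀ : ℝ, t₀ ∈ Ioc 0 T → ∀ (φ : VF) (ψ : ℝ → VF), MemLp φ 2 volume → FunctionSpaces.Torus.IsWeaklyDivFree φ →
    MemLp (FunctionSpaces.Torus.stLift (revCarrier b t₀)) ∞ (volume.restrict (Ioo 0 t₀ ×ˢ (univ : Set (EuclideanSpace ℝ (Fin 3))))) →
    Torus.IsWeakTensorPassiveVectorOn 0 t₀ (Torus.majorTranspose 𝔹) (revCarrier b t₀) φ ψ →
    ∃ c : ℝ, ∀ᵐ s ∂(volume.restrict (Ioo 0 t₀)), ∫ x, ⟪u s x, ψ (t₀ - s) x⟫_ℝ = c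

/-- **D2 (candidate Literature lemma, size M) — strong `L²` right-continuity at `t = 0⁺`.**  A weak solution of the tensor passive-vector
problem (elliptic window, `L^∞` carrier, `L²` weakly div-free datum `w₀`) satisfies `∫‖w s − w₀‖² → 0` as `s ↓ 0` along a.e. `s`: the
energy inequality gives `limsup ‖w s‖² ≤ ‖w₀‖²` and the weak formulation weak convergence `w s ⇀ w₀`. [cite: Evans2010, §7.1.2 Thm. 3] -/
def InitialTrace : Prop :=
  ∀ (T : ℝ) (𝔹 : Torus.Visc4 (Fin 3)) (lo hi : ℝ), Torus.NearIso 𝔹 lo hi → 0 < lo →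
  ∀ (b : ℝ → VF), MemLp (FunctionSpaces.Torus.stLift b) ∞ (volume.restrict (Ioo 0 T ×ˢ (univ : Set (EuclideanSpace ℝ (Fin 3))))) →
  ∀ (w₀ : VF) (w : ℝ → VF), MemLp w₀ 2 volume → FunctionSpaces.Torus.IsWeaklyDivFree w₀ →
    Torus.IsWeakTensorPassiveVectorOn 0 T 𝔹 b w₀ w →
  ∀ ε > (0:ℝ), ∃ δ > (0:ℝ), ∀ᵐ s ∂(volume.restrict (Ioo 0 T)), s < δ → ∫ x, ‖w s x - w₀ x‖ ^ 2 ≤ ε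

/-- **D3 (candidate Literature lemma, size M) — weak continuity in time.**  For every fixed `L²` field `φ`, the pairing `t ↦ ∫⟪w t, φ⟫` of a
weak solution has a representative continuous on `(0,T)` (mode-wise `W^{1,1}` in time by the weak formulation with tests `θ(t)·P_Nφ`,
uniform tail `‖(1−P_N)φ‖·sup_t‖w t‖`). [cite: Evans2010, §7.1.2 Thm. 3] -/
def ContinuousRepr : Prop :=
  ∀ (T : ℝ) (𝔹 : Torus.Visc4 (Fin 3)) (lo hi : ℝ), Torus.NearIso 𝔹 lo hi → 0 < lo →
  ∀ (b : ℝ → VF), MemLp (FunctionSpaces.Torus.stLift b) ∞ (volume.restrict (Ioo 0 T ×ˢ (univ : Set (EuclideanSpace ℝ (Fin 3))))) →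
  ∀ (w₀ : VF) (w : ℝ → VF), MemLp w₀ 2 volume → FunctionSpaces.Torus.IsWeaklyDivFree w₀ →
    Torus.IsWeakTensorPassiveVectorOn 0 T 𝔹 b w₀ w →
  ∀ φ : VF, MemLp φ 2 volume →
    ∃ G : ℝ → ℝ, ContinuousOn G (Ioo 0 T) ∧ ∀ᵐ t ∂(volume.restrict (Ioo 0 T)), ∫ x, ⟪w t x, φ x⟫_ℝ = G t

/-- **The duality bound** (consequence of D1–D3, proved below): for a.e. `t₀ ∈ (0,T)`, every adjoint solution `ψ` from the datum `φ` and
every a.e. bound `|∫⟪F, ψ r⟫| ≤ B` on `(0,t₀)` give `|∫⟪u t₀, φ⟫| ≤ B`. -/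
def DualityBound : Prop :=
  ∀ (T : ℝ) (𝔹 : Torus.Visc4 (Fin 3)) (lo hi : ℝ), Torus.NearIso 𝔹 lo hi → 0 < lo →
  ∀ (b : ℝ → VF), MemLp (FunctionSpaces.Torus.stLift b) ∞ (volume.restrict (Ioo 0 T ×ˢ (univ : Set (EuclideanSpace ℝ (Fin 3))))) →
  ∀ (F : VF) (u : ℝ → VF), MemLp F 2 volume → FunctionSpaces.Torus.IsWeaklyDivFree F →
    Torus.IsWeakTensorPassiveVectorOn 0 T 𝔹 b F u →
  ∀ φ : VF, MemLp φ 2 volume → FunctionSpaces.Torus.IsWeaklyDivFree φ →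
    ∀ᵐ t₀ ∂(volume.restrict (Ioo 0 T)), ∀ ψ : ℝ → VF,
      MemLp (FunctionSpaces.Torus.stLift (revCarrier b t₀)) ∞ (volume.restrict (Ioo 0 t₀ ×ˢ (univ : Set (EuclideanSpace ℝ (Fin 3))))) →
      Torus.IsWeakTensorPassiveVectorOn 0 t₀ (Torus.majorTranspose 𝔹) (revCarrier b t₀) φ ψ →
      ∀ B : ℝ, (∀ᵐ r ∂(volume.restrict (Ioo 0 t₀)), |∫ x, ⟪F x, ψ r x⟫_ℝ| ≤ B) → |∫ x, ⟪u t₀ x, φ x⟫_ℝ| ≤ B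

/-- **`DualityBound` from D1–D3** (the «control» assembly, PROVED).  At an a.e. `t₀` where `⟨u ·, φ⟩` agrees with its continuous
representative `G` (D3): the constant `c` of D1 satisfies `|c| ≤ B` (evaluate near `s = 0`, where `u s → F` strongly by D2 for `u` and
`‖ψ(t₀−s)‖² ≤ ‖φ‖²` by the adjoint energy inequality) and `c = G t₀` (evaluate near `s = t₀`, where `ψ(t₀−s) → φ` strongly by D2 for `ψ`,
`‖u s‖² ≤ ‖F‖²`, and `G` is continuous at `t₀`). -/
theorem dualityBound_of (h1 : PairingConst) (h2 : InitialTrace) (h3 : ContinuousRepr) : DualityBound := by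
  intro T 𝔹 lo hi hN hlo b hb F u hF2 hFdiv hu φ hφ2 hφdiv
  obtain ⟨G, hGc, hGae⟩ := h3 T 𝔹 lo hi hN hlo b hb F u hF2 hFdiv hu φ hφ2
  have hEF0 : 0 ≤ ∫ x, ‖F x‖ ^ 2 := integral_nonneg fun _ => by positivity
  have hEφ0 : 0 ≤ ∫ x, ‖φ x‖ ^ 2 := integral_nonneg fun _ => by positivity
  -- energy bound and slice `L²` membership for `u`
  have hEu : ∀ᵐ s ∂(volume.restrict (Ioo 0 T)), ∫ x, ‖u s x‖ ^ 2 ≤ ∫ x, ‖F x‖ ^ 2 := by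
    filter_upwards [hu.ae_energy_ineq hN hlo hF2 hFdiv hb] with s hs
    exact (ENNReal.ofReal_le_ofReal_iff hEF0).1 (le_trans le_self_add hs)
  have hu2 := hu.ae_memLp_two
  filter_upwards [hGae, ae_restrict_mem measurableSet_Ioo] with t₀ hG₀ ht₀
  intro ψ hbrev hψ B hB
  have hN' : Torus.NearIso (Torus.majorTranspose 𝔹) lo hi := (Torus.nearIso_majorTranspose_iff 𝔹 lo hi).2 hN
  obtain ⟨c, hc⟩ := h1 T 𝔹 lo hi hN hlo b hb F u hF2 hFdiv hu t₀ ⟨ht₀.1, ht₀.2.le⟩ φ ψ hφ2 hφdiv hbrev hψ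
  have hEψ : ∀ᵐ r ∂(volume.restrict (Ioo 0 t₀)), ∫ x, ‖ψ r x‖ ^ 2 ≤ ∫ x, ‖φ x‖ ^ 2 := by
    filter_upwards [hψ.ae_energy_ineq hN' hlo hφ2 hφdiv hbrev] with r hr
    exact (ENNReal.ofReal_le_ofReal_iff hEφ0).1 (le_trans le_self_add hr)
  have hψ2 := hψ.ae_memLp_two
  have hsub : Ioo 0 t₀ ⊆ Ioo 0 T := Ioo_subset_Ioo_right ht₀.2.le
  -- ### Step A: `|c| ≤ B` (look near `s = 0`)
  have hA : |c| ≤ B := by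
    refine le_of_forall_pos_le_add fun κ hκ => ?_
    obtain ⟨δ, hδ, hδu⟩ := h2 T 𝔹 lo hi hN hlo b hb F u hF2 hFdiv hu (κ * (κ / ((∫ x, ‖φ x‖ ^ 2) + 1))) (by positivity)
    have hall : ∀ᵐ s ∂(volume.restrict (Ioo 0 t₀)),
        (∫ x, ⟪u s x, ψ (t₀ - s) x⟫_ℝ = c) ∧
        (s < δ → ∫ x, ‖u s x - F x‖ ^ 2 ≤ κ * (κ / ((∫ x, ‖φ x‖ ^ 2) + 1))) ∧
        (∫ x, ‖ψ (t₀ - s) x‖ ^ 2 ≤ ∫ x, ‖φ x‖ ^ 2) ∧ MemLp (ψ (t₀ - s)) 2 volume ∧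
        |∫ x, ⟪F x, ψ (t₀ - s) x⟫_ℝ| ≤ B ∧ MemLp (u s) 2 volume := by
      filter_upwards [hc, ae_restrict_of_ae_restrict_of_subset hsub hδu, ae_restrict_Ioo_reflect hEψ,
        ae_restrict_Ioo_reflect hψ2, ae_restrict_Ioo_reflect hB, ae_restrict_of_ae_restrict_of_subset hsub hu2]
        with s h1' h2' h3' h4' h5' h6'
      exact ⟨h1', h2', h3', h4', h5', h6'⟩
    have hδ'0 : 0 < min δ t₀ := lt_min hδ ht₀.1
    have hsub' : Ioo 0 (min δ t₀) ⊆ Ioo 0 t₀ := Ioo_subset_Ioo_right (min_le_right _ _)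
    obtain ⟨s, hsI, hcs, hδs, hEs, hψs, hBs, hus⟩ :=
      exists_of_ae_Ioo hδ'0 (ae_restrict_of_ae_restrict_of_subset hsub' hall)
    have hsδ : s < δ := lt_of_lt_of_le hsI.2 (min_le_left _ _)
    have hf2 : MemLp (fun x => u s x - F x) 2 volume := hus.sub hF2
    have hsplit : ∫ x, ⟪u s x, ψ (t₀ - s) x⟫_ℝ =
        (∫ x, ⟪F x, ψ (t₀ - s) x⟫_ℝ) + ∫ x, ⟪u s x - F x, ψ (t₀ - s) x⟫_ℝ := by
      rw [← integral_add (integrable_inner₂ hF2 hψs) (integrable_inner₂ hf2 hψs)]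
      refine integral_congr_ae (ae_of_all _ fun x => ?_)
      show ⟪u s x, ψ (t₀ - s) x⟫_ℝ = ⟪F x, ψ (t₀ - s) x⟫_ℝ + ⟪u s x - F x, ψ (t₀ - s) x⟫_ℝ
      rw [inner_sub_left]; ring
    have hsmall := abs_integral_inner_le_of_small hf2 hψs hκ hEφ0 (hδs hsδ) hEs
    calc |c| = |(∫ x, ⟪F x, ψ (t₀ - s) x⟫_ℝ) + ∫ x, ⟪u s x - F x, ψ (t₀ - s) x⟫_ℝ| := by rw [← hsplit, hcs]
      _ ≤ |∫ x, ⟪F x, ψ (t₀ - s) x⟫_ℝ| + |∫ x, ⟪u s x - F x, ψ (t₀ - s) x⟫_ℝ| := abs_add_le _ _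
      _ ≤ B + κ := add_le_add hBs hsmall
  -- ### Step B: `G t₀ = c` (look near `s = t₀`)
  have hB' : G t₀ = c := by
    have key : ∀ κ > (0:ℝ), |G t₀ - c| ≤ 2 * κ := by
      intro κ hκ
      obtain ⟨ρ, hρ, hρG⟩ := Metric.continuousWithinAt_iff.1 (hGc t₀ ht₀) κ hκ
      obtain ⟨δ₂, hδ₂, hδψ⟩ := h2 t₀ (Torus.majorTranspose 𝔹) lo hi hN' hlo (revCarrier b t₀) hbrev φ ψ hφ2 hφdiv hψ
        (κ * (κ / ((∫ x, ‖F x‖ ^ 2) + 1))) (by positivity)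
      have hall : ∀ᵐ s ∂(volume.restrict (Ioo 0 t₀)),
          (∫ x, ⟪u s x, ψ (t₀ - s) x⟫_ℝ = c) ∧
          (t₀ - s < δ₂ → ∫ x, ‖ψ (t₀ - s) x - φ x‖ ^ 2 ≤ κ * (κ / ((∫ x, ‖F x‖ ^ 2) + 1))) ∧
          (∫ x, ‖u s x‖ ^ 2 ≤ ∫ x, ‖F x‖ ^ 2) ∧ MemLp (u s) 2 volume ∧ (∫ x, ⟪u s x, φ x⟫_ℝ = G s) ∧
          MemLp (ψ (t₀ - s)) 2 volume := by
        filter_upwards [hc, ae_restrict_Ioo_reflect hδψ, ae_restrict_of_ae_restrict_of_subset hsub hEu,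
          ae_restrict_of_ae_restrict_of_subset hsub hu2, ae_restrict_of_ae_restrict_of_subset hsub hGae,
          ae_restrict_Ioo_reflect hψ2] with s h1' h2' h3' h4' h5' h6'
        exact ⟨h1', h2', h3', h4', h5', h6'⟩
      have hm1 : min (min δ₂ ρ) t₀ ≤ t₀ := min_le_right _ _
      have hm2 : min (min δ₂ ρ) t₀ ≤ δ₂ := (min_le_left _ _).trans (min_le_left _ _)
      have hm3 : min (min δ₂ ρ) t₀ ≤ ρ := (min_le_left _ _).trans (min_le_right _ _)
      have hδ₃0 : 0 < min (min δ₂ ρ) t₀ := lt_min (lt_min hδ₂ hρ) ht₀.1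
      have hsub' : Ioo (t₀ - min (min δ₂ ρ) t₀) t₀ ⊆ Ioo 0 t₀ := Ioo_subset_Ioo_left (by linarith)
      obtain ⟨s, hsI, hcs, hδs, hEs, hus, hGs, hψs⟩ :=
        exists_of_ae_Ioo (by linarith : t₀ - min (min δ₂ ρ) t₀ < t₀) (ae_restrict_of_ae_restrict_of_subset hsub' hall)
      have hs2 : t₀ - s < δ₂ := by linarith [hsI.1]
      have hsρ : dist s t₀ < ρ := by
        rw [Real.dist_eq, abs_sub_comm, abs_of_pos (by linarith [hsI.2])]
        linarith [hsI.1]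
      have hsT : s ∈ Ioo 0 T := hsub (hsub' hsI)
      have hGκ : dist (G s) (G t₀) < κ := hρG hsT hsρ
      have hg2 : MemLp (fun x => ψ (t₀ - s) x - φ x) 2 volume := hψs.sub hφ2
      have hsplit : ∫ x, ⟪u s x, ψ (t₀ - s) x⟫_ℝ =
          (∫ x, ⟪u s x, φ x⟫_ℝ) + ∫ x, ⟪ψ (t₀ - s) x - φ x, u s x⟫_ℝ := by
        rw [← integral_add (integrable_inner₂ hus hφ2) (integrable_inner₂ hg2 hus)]
        refine integral_congr_ae (ae_of_all _ fun x => ?_)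
        show ⟪u s x, ψ (t₀ - s) x⟫_ℝ = ⟪u s x, φ x⟫_ℝ + ⟪ψ (t₀ - s) x - φ x, u s x⟫_ℝ
        rw [real_inner_comm (u s x) (ψ (t₀ - s) x - φ x), inner_sub_right]; ring
      have hsmall := abs_integral_inner_le_of_small hg2 hus hκ hEF0 (hδs hs2) hEs
      have e1 : c - G s = ∫ x, ⟪ψ (t₀ - s) x - φ x, u s x⟫_ℝ := by rw [← hcs, hsplit, hGs]; ring
      rw [Real.dist_eq] at hGκ
      calc |G t₀ - c| ≤ |G t₀ - G s| + |G s - c| := abs_sub_le _ _ _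
        _ ≤ κ + κ := by
            refine add_le_add ?_ ?_
            · rw [abs_sub_comm]; exact hGκ.le
            · rw [abs_sub_comm, e1]; exact hsmall
        _ = 2 * κ := by ring
    by_contra hne
    have hpos : 0 < |G t₀ - c| := abs_pos.2 (sub_ne_zero.2 hne)
    have := key (|G t₀ - c| / 4) (by positivity)
    linarith
  rw [hG₀, hB']
  exact hA

/-! ## §3 Candidate texts of the line and the proved glue to the v21 stub -/

/-- **`CarrierFastContent` (candidate SUPPORT text, size S)** — `cell_corrector_content`'s fast-block computation for a GENERAL carrier
with the three properties its proof uses (`L^∞` lift, sup bound `k/(2πn)`, invariance under the `n`-torsion grid), a GENERAL constant tensor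
`𝔹` in an elliptic window `[lo', hi']`, and a GENERAL `L²` weakly div-free datum supported on the modes `{±ℓ}` (`2|ℓᵢ| ≤ n`): the energy of
every weak solution off `{±ℓ}` is at most `(3·(k/(2πn))·(2π‖ℓ‖))²·‖φ‖² / (4π²·lo'·(n²/4))²` for a.e. `t` (`ae_mFourierCoeff_eq_zero_off_sector`
+ `freqNormSq_ge_of_sector` + `ae_complement_energy_le`).  Used with `𝔹 = majorTranspose ((1/n²)•𝔸)`, `lo' = νlo/(λn²)`, carrier
`revCarrier (cellField …) t₀` (§1), where the bound reads `9k²λ²‖ℓ‖²‖φ‖²/(π⁴n²ν²lo²)`. [cite: ChavesGawedzkiHorvaiKupiainenVergassola2003, §V] -/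
def CarrierFastContent : Prop :=
  ∀ (k n : ℕ), 0 < n → ∀ (b' : ℝ → VF) (T' : ℝ),
    MemLp (FunctionSpaces.Torus.stLift b') ∞ (volume.restrict (Ioo 0 T' ×ˢ (univ : Set (EuclideanSpace ℝ (Fin 3))))) →
    (∀ s x, ‖b' s x‖ ≤ (k:ℝ) / (2 * Real.pi * n)) →
    (∀ (j : Fin 3 → Fin n) (s : ℝ) (x : UnitAddTorus (Fin 3)),
        b' s (x + fun i => ((((j i : ℕ) : ℝ) / n : ℝ) : UnitAddCircle)) = b' s x) →
  ∀ (𝔹 : Torus.Visc4 (Fin 3)) (lo' hi' : ℝ), Torus.NearIso 𝔹 lo' hi' → 0 < lo' →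
  ∀ ℓ : Fin 3 → ℤ, ℓ ≠ 0 → (∀ i, 2 * |(ℓ i : ℝ)| ≤ n) →
  ∀ φ : VF, MemLp φ 2 volume → FunctionSpaces.Torus.IsWeaklyDivFree φ →
    (∀ k' : Fin 3 → ℤ, k' ≠ ℓ → k' ≠ -ℓ → mFourierCoeff (FunctionSpaces.EuclideanSpace.complexify ∘ φ) k' = 0) →
  ∀ ψ : ℝ → VF, Torus.IsWeakTensorPassiveVectorOn 0 T' 𝔹 b' φ ψ →
    ∀ᵐ r ∂(volume.restrict (Ioo 0 T')),
      (∫ x, ‖ψ r x‖ ^ 2) -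
          (‖mFourierCoeff (FunctionSpaces.EuclideanSpace.complexify ∘ ψ r) ℓ‖ ^ 2 +
            ‖mFourierCoeff (FunctionSpaces.EuclideanSpace.complexify ∘ ψ r) (-ℓ)‖ ^ 2)
        ≤ (3 * ((k:ℝ) / (2 * Real.pi * n)) * (2 * Real.pi * ‖Torus.latticeVec ℓ‖)) ^ 2 * (∫ x, ‖φ x‖ ^ 2) /
            (4 * Real.pi ^ 2 * lo' * ((n:ℝ) ^ 2 / 4)) ^ 2

/-- **`UniformSlowLeak` (candidate text of the (F) half of `stub_cellEnergyT`, size M given `DualityBound`, `CarrierFastContent`,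
`exists_adjoint`)** — clause (F) of `CellEnergyClausesNoE` UNIFORMLY IN `T` with the explicit constant `36k²Λ²/(π⁴lo²c)`, for every
`0 < ν₀`, `2ν₀ ≤ K`.  Recipe: fix `ν, n, 𝔸, λ, L, F, T, u`; `2L < n` since `⌈K/ν⌉₊ ≥ 3`; for a.e. `t₀` (countably many `φ`'s:
`ae_all_iff` over `ℓ ∈ ℤ³`, two transverse unit `p ⊥ ℓ`, `Re`/`Im`): `ψ` from `exists_adjoint`; `B := ‖P_{Σ(ℓ)}F‖·√D` bounds `|∫⟪F, ψ r⟫|`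
a.e. by `CarrierFastContent` (`F̂` vanishes on `{±ℓ}`, `ψ r` lives on `Σ(ℓ) = {±ℓ}+nℤ³` by `ae_mFourierCoeff_eq_zero_off_sector`, Parseval
`FunctionSpaces.Torus` API as in `cell_corrector_content` §1/§4); `DualityBound` ⇒ `|∫⟪u t₀, φ⟫| ≤ B`; `sectorEnergy ℓ (u t₀) = Σ_p |p·û(ℓ)|²`
(longitudinal part `0`: `ae_isWeaklyDivFree`); sum over the slow box of `lowEnergy L` (mode `0` vanishes by mean conservation; pair-sectors of
distinct pairs disjoint as `2L < n`; `‖ℓ‖² ≤ L²`, `λ ≤ Λ`). -/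
def UniformSlowLeak : Prop :=
  ∀ (k : ℕ) (W : LatticeWord k) (M : ℝ) (hM : 0 < M) (c : ℝ), 0 < c →
  ∀ (lo hi Λ β : ℝ), 0 < lo → 1 ≤ Λ → ∀ (ν₀ K : ℝ), 0 < ν₀ → 2 * ν₀ ≤ K →
  ∀ ν, ∀ hν : ν ∈ Set.Ioo 0 ν₀, ∀ n : ℕ, ∀ 𝔸 : Torus.Visc4 (Fin 3),
    Torus.OddSmall 𝔸 (ν * β) → (∃ lam ∈ Set.Icc (1:ℝ) Λ, Torus.NearIso 𝔸 (ν * (lo / lam)) (ν * (hi * lam))) →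
    ∀ L > (0:ℝ), L * (⌈K / ν⌉₊ : ℝ) ≤ n → ∀ F : VF, IsDatum F →
      (∀ k' : Fin 3 → ℤ, ‖Torus.latticeVec k'‖ < (n:ℝ) / 2 → ∀ i, modeCoeff k' F i = 0) →
      ∀ T > (0:ℝ), ∀ u : ℝ → VF,
        Torus.IsWeakTensorPassiveVectorOn 0 T ((1 / (n:ℝ) ^ 2) • 𝔸) (cellField W M hM ν hν.1 n) F u →
        ∀ᵐ t ∂(volume.restrict (Ioo 0 T)),
          lowEnergy L (u t) ≤ (36 * (k:ℝ) ^ 2 * Λ ^ 2 / (Real.pi ^ 4 * lo ^ 2 * c)) * (c * L ^ 2 / ((n:ℝ) ^ 2 * ν ^ 2)) *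
            ∫ x, ‖F x‖ ^ 2

/-- **Glue (PROVED): `UniformSlowLeak` closes the v21 stub `stub_cellEnergyT` AS TYPED** (statement copied verbatim from
`Cruxes/LagrangianRenormalisationStep/Lines/onelevel.lean` v21), with `C = 36k²Λ²/(π⁴lo²c)`, `ν₀ = 1`, `K = 2`; clause (C) is the landed
`cell_corrector_content` (p634914, constant `9k²Λ²/(π⁴lo²c) ≤ C`). -/
theorem cellEnergyT_of_uniformSlowLeak (hU : UniformSlowLeak) :
    ∀ k (W : Literature.Analysis.FluidPDE.LatticeShear.LatticeWord k) (M : ℝ) (hM : 0 < M) (c : ℝ), 0 < c →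
    ∀ lo hi Λ β : ℝ, 0 < lo → lo ≤ 1 → 1 ≤ hi → 1 < Λ → 0 ≤ β →
      ∃ C : ℝ, 0 ≤ C ∧ ∃ ν₀ > (0:ℝ), ∃ K > (0:ℝ), CellEnergyClausesNoE W M hM c lo hi Λ β C ν₀ K := by
  intro k W M hM c hc lo hi Λ β hlo _hlo1 _hhi hΛ _hβ
  refine ⟨36 * (k:ℝ) ^ 2 * Λ ^ 2 / (Real.pi ^ 4 * lo ^ 2 * c), by positivity, 1, one_pos, 2, two_pos, ?_⟩
  intro ν hν n 𝔸 hodd hwin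
  refine ⟨?_, ?_⟩
  · intro L hL hLn F hF hFhigh T hT u hu
    exact hU k W M hM c hc lo hi Λ β hlo hΛ.le 1 2 one_pos (by norm_num) ν hν n 𝔸 hodd hwin L hL hLn F hF hFhigh T hT u hu
  · intro ℓ hℓ hband p hp hpℓ T hT w hw
    have h := cell_corrector_content W M hM hc hlo hΛ.le one_pos (by norm_num : (1:ℝ) ≤ 2) ν hν n 𝔸 hodd hwin ℓ hℓ hband p hp
      hpℓ T hT w hw
    filter_upwards [h] with t ht
    refine ht.trans ?_
    have hnn : 0 ≤ (c * ‖Torus.latticeVec ℓ‖ ^ 2 / ((n:ℝ) ^ 2 * ν ^ 2)) * ∫ x, ‖(UnitAddTorus.mFourier ℓ x).re • p‖ ^ 2 :=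
      mul_nonneg (by positivity) (integral_nonneg fun _ => by positivity)
    have hC : 9 * (k:ℝ) ^ 2 * Λ ^ 2 / (Real.pi ^ 4 * lo ^ 2 * c) ≤ 36 * (k:ℝ) ^ 2 * Λ ^ 2 / (Real.pi ^ 4 * lo ^ 2 * c) :=
      div_le_div_of_nonneg_right (by nlinarith [mul_nonneg (sq_nonneg (k:ℝ)) (sq_nonneg Λ)]) (by positivity)
    calc 9 * (k:ℝ) ^ 2 * Λ ^ 2 / (Real.pi ^ 4 * lo ^ 2 * c) * (c * ‖Torus.latticeVec ℓ‖ ^ 2 / ((n:ℝ) ^ 2 * ν ^ 2)) *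
            ∫ x, ‖(UnitAddTorus.mFourier ℓ x).re • p‖ ^ 2
          = 9 * (k:ℝ) ^ 2 * Λ ^ 2 / (Real.pi ^ 4 * lo ^ 2 * c) *
            ((c * ‖Torus.latticeVec ℓ‖ ^ 2 / ((n:ℝ) ^ 2 * ν ^ 2)) * ∫ x, ‖(UnitAddTorus.mFourier ℓ x).re • p‖ ^ 2) := by ring
      _ ≤ 36 * (k:ℝ) ^ 2 * Λ ^ 2 / (Real.pi ^ 4 * lo ^ 2 * c) *
            ((c * ‖Torus.latticeVec ℓ‖ ^ 2 / ((n:ℝ) ^ 2 * ν ^ 2)) * ∫ x, ‖(UnitAddTorus.mFourier ℓ x).re • p‖ ^ 2) :=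
          mul_le_mul_of_nonneg_right hC hnn
      _ = _ := by ring


/-! ## §4 (v2) Typed split of `UniformSlowLeak` and its PROVED assembly

`UniformSlowLeak` ⇐ `SlowModeBound` (M — the real content: per slow mode, `exists_adjoint` + `CarrierFastContent` + `DualityBound` + the
transverse-polarisation / `Re`-`Im` bookkeeping) + `SectorCount` (S — Parseval and disjointness of the pair-sectors of distinct slow pairs when
`2L < n`) + `MeanConservation` (S — the mode `0` of a weak solution is that of the datum: `weak_eq` with the constant tests `θ(t)·e`).
The assembly `uniformSlowLeak_of` below is proved (constants close exactly on the stub's text). -/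

/-- The slow box of `lowEnergy L` (its index Finset, verbatim). -/
def slowBox (L : ℝ) : Finset (Fin 3 → ℤ) :=
  (Fintype.piFinset fun _ : Fin 3 => Finset.Icc (-⌈L⌉) ⌈L⌉).filter (fun k => ‖Torus.latticeVec k‖ ≤ L)

theorem lowEnergy_eq_sum (L : ℝ) (f : VF) : lowEnergy L f = ∑ k ∈ slowBox L, sectorEnergy k f := rfl

theorem zero_mem_slowBox {L : ℝ} (hL : 0 ≤ L) : (0 : Fin 3 → ℤ) ∈ slowBox L := by
  refine Finset.mem_filter.2 ⟨Fintype.mem_piFinset.2 fun i => Finset.mem_Icc.2 ⟨?_, ?_⟩, ?_⟩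
  · simp only [Pi.zero_apply, Left.neg_nonpos_iff]; exact Int.ceil_nonneg hL
  · simp only [Pi.zero_apply]; exact Int.ceil_nonneg hL
  · rw [Torus.latticeVec_zero, norm_zero]; exact hL

theorem norm_le_of_mem_slowBox {L : ℝ} {ℓ : Fin 3 → ℤ} (h : ℓ ∈ slowBox L) : ‖Torus.latticeVec ℓ‖ ≤ L :=
  (Finset.mem_filter.1 h).2

/-- The pair-sector `{±ℓ} + nℤ³` of the frequency `ℓ`. -/
def PairSector (n : ℕ) (ℓ : Fin 3 → ℤ) : Set (Fin 3 → ℤ) :=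
  {k' | (∀ i, (n:ℤ) ∣ k' i - ℓ i) ∨ ∀ i, (n:ℤ) ∣ k' i + ℓ i}

/-- The energy of `F` carried by the pair-sector of `ℓ` (`‖P_{Σ(ℓ)}F‖²`; summable for `F ∈ L²`). -/
def pairSectorEnergy (n : ℕ) (ℓ : Fin 3 → ℤ) (F : VF) : ℝ := ∑' k' : PairSector n ℓ, sectorEnergy (k' : Fin 3 → ℤ) F

theorem pairSectorEnergy_nonneg (n : ℕ) (ℓ : Fin 3 → ℤ) (F : VF) : 0 ≤ pairSectorEnergy n ℓ F :=
  tsum_nonneg fun _ => sectorEnergy_nonneg _ _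

/-- **`SlowModeBound` (candidate text, size M — the content of the line).**  For every weak cell solution `u` from fluctuation data `F` (no modes
below `n/2`) and every slow mode `ℓ ≠ 0`, `2‖ℓ‖ < n`: `sectorEnergy ℓ (u t) ≤ 18k²λ²‖ℓ‖²/(π⁴n²ν²lo²) · ‖P_{Σ(ℓ)}F‖²` for a.e. `t`.
Proof route: for the two transverse unit `p ⊥ ℓ` and `φ ∈ {Re e_ℓ·p, Im e_ℓ·p}` (`‖φ‖² = 1/2`): `ψ` from `exists_adjoint` (a.e. `t` as `t₀`),
`|∫⟪F, ψ r⟫| ≤ ‖P_{Σ(ℓ)}F‖·(9k²λ²‖ℓ‖²·(1/2)/(π⁴n²ν²lo²))^{1/2}` a.e. `r` by `CarrierFastContent` (§1 gives the carrier hypotheses; `ψ r` lives on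
`Σ(ℓ)` by `ae_mFourierCoeff_eq_zero_off_sector`, `F̂(±ℓ) = 0`), `DualityBound`; then `|p·û(t)(ℓ)|² = ⟨u t, Re e_ℓ p⟩² + ⟨u t, Im e_ℓ p⟩²` and
`ℓ·û(t)(ℓ) = 0` (`ae_isWeaklyDivFree`). -/
def SlowModeBound : Prop :=
  ∀ (k : ℕ) (W : LatticeWord k) (M : ℝ) (hM : 0 < M) (lo hi lam : ℝ), 0 < lo → 1 ≤ lam →
  ∀ (ν : ℝ) (hν : 0 < ν) (n : ℕ), 0 < n → ∀ 𝔸 : Torus.Visc4 (Fin 3), Torus.NearIso 𝔸 (ν * (lo / lam)) (ν * (hi * lam)) →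
  ∀ F : VF, IsDatum F → (∀ k' : Fin 3 → ℤ, ‖Torus.latticeVec k'‖ < (n:ℝ) / 2 → ∀ i, modeCoeff k' F i = 0) →
  ∀ (T : ℝ) (u : ℝ → VF), Torus.IsWeakTensorPassiveVectorOn 0 T ((1 / (n:ℝ) ^ 2) • 𝔸) (cellField W M hM ν hν n) F u →
  ∀ ℓ : Fin 3 → ℤ, ℓ ≠ 0 → 2 * ‖Torus.latticeVec ℓ‖ < n →
    ∀ᵐ t ∂(volume.restrict (Ioo 0 T)),
      sectorEnergy ℓ (u t) ≤
        18 * (k:ℝ) ^ 2 * lam ^ 2 * ‖Torus.latticeVec ℓ‖ ^ 2 / (Real.pi ^ 4 * (n:ℝ) ^ 2 * ν ^ 2 * lo ^ 2) * pairSectorEnergy n ℓ F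

/-- **`SectorCount` (candidate text, size S).**  The pair-sectors of distinct slow pairs `{±ℓ}` (`‖ℓ‖ ≤ L`, `2L < n`) are disjoint and
`Σ(ℓ) = Σ(−ℓ)`, so by Parseval `Σ_{0 ≠ ℓ ∈ slowBox L} ‖P_{Σ(ℓ)}F‖² ≤ 2‖F‖²`. -/
def SectorCount : Prop :=
  ∀ (n : ℕ) (L : ℝ), 0 < L → 2 * L < n → ∀ F : VF, IsDatum F →
    ∑ ℓ ∈ (slowBox L).erase 0, pairSectorEnergy n ℓ F ≤ 2 * ∫ x, ‖F x‖ ^ 2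

/-- **`MeanConservation` (candidate text, size S).**  The mean (mode `0`) of a weak solution of the tensor passive-vector problem is that of
its datum for a.e. `t` (`weak_eq` with the constant div-free tests `θ(t)·eᵢ`: `convect b (const) = 0`, `viscAdj 𝔹 (const) = 0`). -/
def MeanConservation : Prop :=
  ∀ (T : ℝ) (𝔹 : Torus.Visc4 (Fin 3)) (b : ℝ → VF),
    MemLp (FunctionSpaces.Torus.stLift b) ∞ (volume.restrict (Ioo 0 T ×ˢ (univ : Set (EuclideanSpace ℝ (Fin 3))))) →
  ∀ (w₀ : VF) (w : ℝ → VF), MemLp w₀ 2 volume → Torus.IsWeakTensorPassiveVectorOn 0 T 𝔹 b w₀ w →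
    ∀ᵐ t ∂(volume.restrict (Ioo 0 T)), ∀ i, modeCoeff 0 (w t) i = modeCoeff 0 w₀ i

/-- Two slow frequencies congruent modulo the cell grid coincide (`|ℓᵢ − ℓ'ᵢ| ≤ 2L < n`). [folklore] -/
theorem eq_of_slow_congr {n : ℕ} {L : ℝ} (hLn : 2 * L < n) {ℓ ℓ' : Fin 3 → ℤ} (hℓ : ℓ ∈ slowBox L) (hℓ' : ℓ' ∈ slowBox L)
    (h : ∀ i, (n:ℤ) ∣ ℓ i - ℓ' i) : ℓ = ℓ' := by
  funext i
  have h1 : |(ℓ i : ℝ)| ≤ L := (abs_coord_le_norm_latticeVec ℓ i).trans (norm_le_of_mem_slowBox hℓ)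
  have h2 : |(ℓ' i : ℝ)| ≤ L := (abs_coord_le_norm_latticeVec ℓ' i).trans (norm_le_of_mem_slowBox hℓ')
  have h3 : |((ℓ i - ℓ' i : ℤ) : ℝ)| < n := by
    push_cast
    exact (abs_sub _ _).trans_lt (by linarith)
  have h4 : |ℓ i - ℓ' i| < (n:ℤ) := by exact_mod_cast h3
  exact sub_eq_zero.1 (Int.eq_zero_of_abs_lt_dvd (h i) h4)

/-- Pointwise sector count: a frequency `k'` lies in at most two pair-sectors `Σ(ℓ)`, `0 ≠ ℓ` slow. [folklore] -/
theorem sum_indicator_pairSector_le {n : ℕ} {L : ℝ} (hLn : 2 * L < n) {e : (Fin 3 → ℤ) → ℝ} (he : ∀ k, 0 ≤ e k)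
    (k' : Fin 3 → ℤ) : ∑ ℓ ∈ (slowBox L).erase 0, (PairSector n ℓ).indicator e k' ≤ 2 * e k' := by
  classical
  set B := (slowBox L).erase 0 with hB
  have hsplit : ∀ ℓ ∈ B, (PairSector n ℓ).indicator e k' ≤
      (if (∀ i, (n:ℤ) ∣ k' i - ℓ i) then e k' else 0) + (if (∀ i, (n:ℤ) ∣ k' i + ℓ i) then e k' else 0) := by
    intro ℓ _
    rw [Set.indicator_apply]
    simp only [PairSector, Set.mem_setOf_eq]
    have := he k'
    split_ifs <;> first | linarith | tauto
  refine (Finset.sum_le_sum hsplit).trans ?_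
  rw [Finset.sum_add_distrib, ← Finset.sum_filter, ← Finset.sum_filter, Finset.sum_const, Finset.sum_const, nsmul_eq_mul,
    nsmul_eq_mul]
  have hc1 : (B.filter fun ℓ => ∀ i, (n:ℤ) ∣ k' i - ℓ i).card ≤ 1 := by
    refine Finset.card_le_one.2 fun a ha b hb => ?_
    rw [Finset.mem_filter] at ha hb
    refine eq_of_slow_congr hLn (Finset.mem_of_mem_erase ha.1) (Finset.mem_of_mem_erase hb.1) fun i => ?_
    have := dvd_sub (hb.2 i) (ha.2 i)
    rwa [show k' i - b i - (k' i - a i) = a i - b i by ring] at this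
  have hc2 : (B.filter fun ℓ => ∀ i, (n:ℤ) ∣ k' i + ℓ i).card ≤ 1 := by
    refine Finset.card_le_one.2 fun a ha b hb => ?_
    rw [Finset.mem_filter] at ha hb
    refine eq_of_slow_congr hLn (Finset.mem_of_mem_erase ha.1) (Finset.mem_of_mem_erase hb.1) fun i => ?_
    have := dvd_sub (ha.2 i) (hb.2 i)
    rwa [show k' i + a i - (k' i + b i) = a i - b i by ring] at this
  have h1 : ((B.filter fun ℓ => ∀ i, (n:ℤ) ∣ k' i - ℓ i).card : ℝ) ≤ 1 := by exact_mod_cast hc1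
  have h2 : ((B.filter fun ℓ => ∀ i, (n:ℤ) ∣ k' i + ℓ i).card : ℝ) ≤ 1 := by exact_mod_cast hc2
  have := he k'
  nlinarith

/-- **`SectorCount` holds (PROVED)** — Parseval (`Torus.hasSum_sq_norm_mFourierCoeff_complexify`) and the pointwise count
`sum_indicator_pairSector_le`. [cite: Grafakos2014, Prop. 3.2.7 (3)] -/
theorem sectorCount : SectorCount := by
  intro n L hL hLn F hF
  classical
  have hF2 : MemLp F 2 volume := memLp_two_of_memSobolev_one_complexify hF.1
  have hFi : Integrable F volume := hF2.integrable one_le_two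
  -- Parseval for `e k = sectorEnergy k F`
  have hPars : HasSum (fun k : Fin 3 → ℤ => sectorEnergy k F) (∫ x, ‖F x‖ ^ 2) := by
    have h := FunctionSpaces.Torus.hasSum_sq_norm_mFourierCoeff_complexify hF2
    convert h using 1
    funext k
    exact sectorEnergy_eq hFi k
  have hsum : Summable fun k : Fin 3 → ℤ => sectorEnergy k F := hPars.summable
  have hind : ∀ ℓ, Summable ((PairSector n ℓ).indicator fun k => sectorEnergy k F) := fun ℓ => hsum.indicator _
  -- rewrite each pair-sector energy as an indicator sum and interchange
  have hps : ∀ ℓ, pairSectorEnergy n ℓ F = ∑' k, (PairSector n ℓ).indicator (fun k => sectorEnergy k F) k := fun ℓ =>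
    tsum_subtype (PairSector n ℓ) (fun k => sectorEnergy k F)
  simp_rw [hps]
  rw [← Summable.tsum_finsetSum (fun ℓ _ => hind ℓ)]
  calc ∑' k, ∑ ℓ ∈ (slowBox L).erase 0, (PairSector n ℓ).indicator (fun k => sectorEnergy k F) k
      ≤ ∑' k, 2 * sectorEnergy k F :=
        Summable.tsum_le_tsum (fun k => sum_indicator_pairSector_le hLn (fun k => sectorEnergy_nonneg k F) k)
          (summable_sum fun ℓ _ => hind ℓ) (hsum.mul_left 2)
    _ = 2 * ∫ x, ‖F x‖ ^ 2 := by rw [tsum_mul_left, hPars.tsum_eq]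

/-- The symbol matrix vanishes at the zero frequency. [folklore] -/
theorem symbT_zero_freq (𝔸 : Torus.Visc4 (Fin 3)) (z : EuclideanSpace ℂ (Fin 3)) : Torus.symbT 𝔸 0 z = 0 := by
  ext j
  simp

/-- **`MeanConservation` holds (PROVED)** — the modewise identity `ae_inner_mFourierCoeff_eq` at `k = 0`: the symbol `T_𝔹(0)` and the
advective multipliers `2πi kⱼ` vanish, so `ŵ(t)(0) = ŵ₀(0)` for a.e. `t`. [cite: Temam1984, Ch. III §1.1] -/
theorem meanConservation : MeanConservation := by
  intro T 𝔹 b _hb w₀ w hw₀ hw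
  have hw₀i : Integrable w₀ volume := hw₀.integrable one_le_two
  have hmode : ∀ i : Fin 3, ∀ᵐ t ∂(volume.restrict (Ioo 0 T)),
      ⟪mFourierCoeff (FunctionSpaces.EuclideanSpace.complexify ∘ w t) 0, EuclideanSpace.single i (1:ℂ)⟫_ℂ =
        ⟪mFourierCoeff (FunctionSpaces.EuclideanSpace.complexify ∘ w₀) 0, EuclideanSpace.single i (1:ℂ)⟫_ℂ := by
    intro i
    filter_upwards [hw.ae_inner_mFourierCoeff_eq hw₀i 0 (z := EuclideanSpace.single i (1:ℂ)) (by simp)] with t ht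
    rw [ht]
    simp
  filter_upwards [ae_all_iff.2 hmode, hw.ae_integrable_slice] with t ht hint i
  have h1 := ht i
  rw [EuclideanSpace.inner_single_right, EuclideanSpace.inner_single_right, one_mul, one_mul] at h1
  rw [modeCoeff_eq hint.1, modeCoeff_eq hw₀i]
  exact (starRingEnd ℂ).injective h1

/-- **Assembly (PROVED): `SlowModeBound → SectorCount → MeanConservation → UniformSlowLeak`.**  Bookkeeping: `ν < ν₀ ≤ K/2` gives
`⌈K/ν⌉₊ ≥ 3`, so `3L ≤ n` and `2L < n`; mode `0` of `u t` vanishes (mean conservation + no low modes in `F`); each slow `ℓ ≠ 0` contributes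
`≤ 18k²Λ²L²/(π⁴n²ν²lo²)·‖P_{Σ(ℓ)}F‖²`; the sector count gives the factor `2‖F‖²`. -/
theorem uniformSlowLeak_of (hS : SlowModeBound) (hC : SectorCount) (hM0 : MeanConservation) : UniformSlowLeak := by
  intro k W M hM c hc lo hi Λ β hlo hΛ ν₀ K hν₀ h2K ν hν n 𝔸 _hodd hwin L hL hLn F hF hFhigh T _hT u hu
  obtain ⟨lam, hlam, hA⟩ := hwin
  have hνpos : 0 < ν := hν.1
  have hlam0 : 0 < lam := lt_of_lt_of_le one_pos hlam.1
  -- `⌈K/ν⌉₊ ≥ 3`, hence `3L ≤ n`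
  have hKν : (2:ℝ) < K / ν := by
    rw [lt_div_iff₀ hνpos]; nlinarith [hν.2]
  have hceilN : 3 ≤ ⌈K / ν⌉₊ := by
    have h2 : (2:ℝ) < (⌈K / ν⌉₊ : ℝ) := hKν.trans_le (Nat.le_ceil _)
    have h3 : 2 < ⌈K / ν⌉₊ := by exact_mod_cast h2
    omega
  have hceil : (3:ℝ) ≤ (⌈K / ν⌉₊ : ℝ) := by exact_mod_cast hceilN
  have h3L : 3 * L ≤ n := by nlinarith
  have hnR : (0:ℝ) < n := by linarith
  have hn : 0 < n := by exact_mod_cast hnR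
  have h2L : 2 * L < n := by linarith
  -- carrier lift in `L^∞` and the datum in `L²`
  have hb : MemLp (FunctionSpaces.Torus.stLift (cellField W M hM ν hν.1 n)) ∞
      (volume.restrict (Ioo 0 T ×ˢ (univ : Set (EuclideanSpace ℝ (Fin 3))))) := by
    unfold cellField
    exact memLp_top_stLift_cell _ n T
  have hF2 : MemLp F 2 volume := memLp_two_of_memSobolev_one_complexify hF.1
  -- mode `0`
  have hF0 : ∀ i, modeCoeff 0 F i = 0 := hFhigh 0 (by rw [Torus.latticeVec_zero, norm_zero]; positivity)
  have h0 : ∀ᵐ t ∂(volume.restrict (Ioo 0 T)), sectorEnergy 0 (u t) = 0 := by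
    filter_upwards [hM0 T _ _ hb F u hF2 hu] with t ht
    simp only [sectorEnergy, ht, hF0, norm_zero]
    simp
  -- per-mode bounds on the punctured slow box
  have hmode : ∀ᵐ t ∂(volume.restrict (Ioo 0 T)), ∀ ℓ ∈ (slowBox L).erase 0,
      sectorEnergy ℓ (u t) ≤
        18 * (k:ℝ) ^ 2 * lam ^ 2 * ‖Torus.latticeVec ℓ‖ ^ 2 / (Real.pi ^ 4 * (n:ℝ) ^ 2 * ν ^ 2 * lo ^ 2) *
          pairSectorEnergy n ℓ F := by
    refine (Filter.eventually_all_finset _).2 fun ℓ hℓ => ?_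
    have hℓ0 : ℓ ≠ 0 := Finset.ne_of_mem_erase hℓ
    have hℓL : ‖Torus.latticeVec ℓ‖ ≤ L := norm_le_of_mem_slowBox (Finset.mem_of_mem_erase hℓ)
    exact hS k W M hM lo hi lam hlo hlam.1 ν hν.1 n hn 𝔸 hA F hF hFhigh T u hu ℓ hℓ0 (by linarith)
  filter_upwards [h0, hmode] with t ht0 ht
  -- the constant per mode is at most `18k²Λ²L²/(π⁴n²ν²lo²)`
  set A : ℝ := 18 * (k:ℝ) ^ 2 * Λ ^ 2 * L ^ 2 / (Real.pi ^ 4 * (n:ℝ) ^ 2 * ν ^ 2 * lo ^ 2) with hAdef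
  have hterm : ∀ ℓ ∈ (slowBox L).erase 0, sectorEnergy ℓ (u t) ≤ A * pairSectorEnergy n ℓ F := by
    intro ℓ hℓ
    have hℓL : ‖Torus.latticeVec ℓ‖ ≤ L := norm_le_of_mem_slowBox (Finset.mem_of_mem_erase hℓ)
    refine (ht ℓ hℓ).trans (mul_le_mul_of_nonneg_right ?_ (pairSectorEnergy_nonneg _ _ _))
    rw [hAdef]
    refine div_le_div_of_nonneg_right ?_ (by positivity)
    have h1 : lam ^ 2 ≤ Λ ^ 2 := pow_le_pow_left₀ hlam0.le hlam.2 2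
    have h2 : ‖Torus.latticeVec ℓ‖ ^ 2 ≤ L ^ 2 := pow_le_pow_left₀ (norm_nonneg _) hℓL 2
    have h3 : 0 ≤ (k:ℝ) ^ 2 := sq_nonneg _
    calc 18 * (k:ℝ) ^ 2 * lam ^ 2 * ‖Torus.latticeVec ℓ‖ ^ 2 = 18 * (k:ℝ) ^ 2 * (lam ^ 2 * ‖Torus.latticeVec ℓ‖ ^ 2) := by ring
      _ ≤ 18 * (k:ℝ) ^ 2 * (Λ ^ 2 * L ^ 2) :=
          mul_le_mul_of_nonneg_left (mul_le_mul h1 h2 (sq_nonneg _) (by positivity)) (by positivity)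
      _ = 18 * (k:ℝ) ^ 2 * Λ ^ 2 * L ^ 2 := by ring
  have hsum : ∑ ℓ ∈ (slowBox L).erase 0, sectorEnergy ℓ (u t) ≤ A * ∑ ℓ ∈ (slowBox L).erase 0, pairSectorEnergy n ℓ F := by
    rw [Finset.mul_sum]
    exact Finset.sum_le_sum hterm
  have hA0 : 0 ≤ A := by rw [hAdef]; positivity
  have hcount := hC n L hL h2L F hF
  rw [lowEnergy_eq_sum, ← Finset.add_sum_erase _ _ (zero_mem_slowBox hL.le), ht0, zero_add]
  calc ∑ ℓ ∈ (slowBox L).erase 0, sectorEnergy ℓ (u t) ≤ A * ∑ ℓ ∈ (slowBox L).erase 0, pairSectorEnergy n ℓ F := hsum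
    _ ≤ A * (2 * ∫ x, ‖F x‖ ^ 2) := mul_le_mul_of_nonneg_left hcount hA0
    _ = 36 * (k:ℝ) ^ 2 * Λ ^ 2 / (Real.pi ^ 4 * lo ^ 2 * c) * (c * L ^ 2 / ((n:ℝ) ^ 2 * ν ^ 2)) * ∫ x, ‖F x‖ ^ 2 := by
        rw [hAdef]
        field_simp
        ring

/-! ## §5 (v3) The net chain: only `SlowModeBound` (M) remains on the bookkeeping side

With `sectorCount` and `meanConservation` proved above, the v21 stub `stub_cellEnergyT` reduces BY NAME to the single modewise duality
statement `SlowModeBound` (whose own inputs are `exists_adjoint` (§1, proved), `CarrierFastContent` (S), `DualityBound` via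
`dualityBound_of` from D1–D3 (Literature half, ad-lit), plus Re/Im and transverse-polarisation bookkeeping). -/

/-- **`SlowModeBound → UniformSlowLeak` (PROVED net split).** [this file] -/
theorem uniformSlowLeak_of_slowModeBound (hS : SlowModeBound) : UniformSlowLeak :=
  uniformSlowLeak_of hS sectorCount meanConservation

/-- **`SlowModeBound` ⇒ the v21 registered stub `stub_cellEnergyT` text verbatim (PROVED net chain).** [this file] -/
theorem cellEnergyT_of_slowModeBound (hS : SlowModeBound) :
    ∀ k (W : Literature.Analysis.FluidPDE.LatticeShear.LatticeWord k) (M : ℝ) (hM : 0 < M) (c : ℝ), 0 < c →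
    ∀ lo hi Λ β : ℝ, 0 < lo → lo ≤ 1 → 1 ≤ hi → 1 < Λ → 0 ≤ β →
      ∃ C : ℝ, 0 ≤ C ∧ ∃ ν₀ > (0:ℝ), ∃ K > (0:ℝ), CellEnergyClausesNoE W M hM c lo hi Λ β C ν₀ K :=
  cellEnergyT_of_uniformSlowLeak (uniformSlowLeak_of_slowModeBound hS)

/-! ## §6 (v4) `SlowModeBound` from D1–D3 and `CarrierFastContent` — helpers -/

/-- Young without square roots: `(∀ α > 0, |x| ≤ α/2·P + D/(2α)) ⇒ x² ≤ P·D`. [folklore] -/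
theorem sq_le_mul_of_young {x P D : ℝ} (hP : 0 ≤ P) (hD : 0 ≤ D)
    (h : ∀ α : ℝ, 0 < α → |x| ≤ α / 2 * P + D / (2 * α)) : x ^ 2 ≤ P * D := by
  by_cases hx : x = 0
  · rw [hx]; simpa using mul_nonneg hP hD
  have hxpos : 0 < |x| := abs_pos.2 hx
  have h2 : ∀ α : ℝ, 0 < α → 2 * α * |x| ≤ α ^ 2 * P + D := by
    intro α hα
    have e : 2 * α * (α / 2 * P + D / (2 * α)) = α ^ 2 * P + D := by field_simp
    calc 2 * α * |x| ≤ 2 * α * (α / 2 * P + D / (2 * α)) := mul_le_mul_of_nonneg_left (h α hα) (by positivity)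
      _ = α ^ 2 * P + D := e
  rcases hP.eq_or_lt with hP0 | hPpos
  · exfalso
    have h3 := h2 ((D + 1) / (2 * |x|)) (by positivity)
    rw [← hP0, mul_zero, zero_add] at h3
    have e : 2 * ((D + 1) / (2 * |x|)) * |x| = D + 1 := by field_simp
    linarith
  · have h3 := h2 (|x| / P) (div_pos hxpos hPpos)
    have e1 : 2 * (|x| / P) * |x| = 2 * (x ^ 2 / P) := by rw [← sq_abs x]; field_simp
    have e2 : (|x| / P) ^ 2 * P = x ^ 2 / P := by rw [div_pow, sq_abs]; field_simp
    rw [e1, e2] at h3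
    have h4 : x ^ 2 / P ≤ D := by linarith
    rw [div_le_iff₀ hPpos] at h4
    linarith [mul_comm D P]

/-- Young for a product: `x y ≤ α/2·x² + y²/(2α)`. [folklore] -/
theorem mul_le_young {α : ℝ} (hα : 0 < α) (x y : ℝ) : x * y ≤ α / 2 * x ^ 2 + y ^ 2 / (2 * α) := by
  have h := sq_nonneg (α * x - y)
  have e : α / 2 * x ^ 2 + y ^ 2 / (2 * α) - x * y = (α * x - y) ^ 2 / (2 * α) := by field_simp; ring
  have : 0 ≤ α / 2 * x ^ 2 + y ^ 2 / (2 * α) - x * y := by rw [e]; positivity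
  linarith

/-- The transverse test vectors `q_j = e_j − (ℓ_j/|ℓ|²) ℓ`. [this sketch] -/
def transVec (ℓ : Fin 3 → ℤ) (j : Fin 3) : EuclideanSpace ℝ (Fin 3) :=
  WithLp.toLp 2 fun i => (if i = j then (1:ℝ) else 0) - (ℓ j : ℝ) * (ℓ i : ℝ) / ‖Torus.latticeVec ℓ‖ ^ 2

theorem transVec_apply (ℓ : Fin 3 → ℤ) (j i : Fin 3) :
    transVec ℓ j i = (if i = j then (1:ℝ) else 0) - (ℓ j : ℝ) * (ℓ i : ℝ) / ‖Torus.latticeVec ℓ‖ ^ 2 := rfl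

theorem norm_latticeVec_pos {ℓ : Fin 3 → ℤ} (hℓ : ℓ ≠ 0) : 0 < ‖Torus.latticeVec ℓ‖ := by
  obtain ⟨i, hi⟩ := Function.ne_iff.1 hℓ
  have hi' : ℓ i ≠ 0 := hi
  have h1 : 0 < |(ℓ i : ℝ)| := abs_pos.2 (by exact_mod_cast hi')
  exact h1.trans_le (abs_coord_le_norm_latticeVec ℓ i)

theorem norm_latticeVec_sq_eq_sum (ℓ : Fin 3 → ℤ) : ‖Torus.latticeVec ℓ‖ ^ 2 = ∑ i, (ℓ i : ℝ) ^ 2 := by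
  rw [norm_latticeVec_sq']; rfl

/-- `q_j ⊥ ℓ`. [this sketch] -/
theorem sum_mul_transVec {ℓ : Fin 3 → ℤ} (hℓ : ℓ ≠ 0) (j : Fin 3) : ∑ i, (ℓ i : ℝ) * transVec ℓ j i = 0 := by
  have hL : ‖Torus.latticeVec ℓ‖ ^ 2 ≠ 0 := pow_ne_zero 2 (norm_latticeVec_pos hℓ).ne'
  simp only [transVec_apply, mul_sub, Finset.sum_sub_distrib, mul_ite, mul_one, mul_zero, Finset.sum_ite_eq',
    Finset.mem_univ, if_true]
  have e : ∑ i, (ℓ i : ℝ) * ((ℓ j : ℝ) * (ℓ i : ℝ) / ‖Torus.latticeVec ℓ‖ ^ 2) =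
      (ℓ j : ℝ) * (∑ i, (ℓ i : ℝ) ^ 2) / ‖Torus.latticeVec ℓ‖ ^ 2 := by
    rw [Finset.mul_sum, Finset.sum_div]
    exact Finset.sum_congr rfl fun i _ => by ring
  rw [e, ← norm_latticeVec_sq_eq_sum, mul_div_assoc, div_self hL, mul_one, sub_self]

/-- `Σ_j ‖q_j‖² = 2` (trace of the projection onto `ℓ^⊥`). [this sketch] -/
theorem sum_norm_sq_transVec {ℓ : Fin 3 → ℤ} (hℓ : ℓ ≠ 0) : ∑ j, ‖transVec ℓ j‖ ^ 2 = 2 := by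
  have hL : ‖Torus.latticeVec ℓ‖ ^ 2 ≠ 0 := pow_ne_zero 2 (norm_latticeVec_pos hℓ).ne'
  have hL' := norm_latticeVec_sq_eq_sum ℓ
  rw [Fin.sum_univ_three] at hL'
  rw [Fin.sum_univ_three, EuclideanSpace.norm_sq_eq (transVec ℓ 0), EuclideanSpace.norm_sq_eq (transVec ℓ 1),
    EuclideanSpace.norm_sq_eq (transVec ℓ 2)]
  simp only [Real.norm_eq_abs, sq_abs, transVec_apply, Fin.sum_univ_three]
  simp only [Fin.isValue, if_true, show ((0:Fin 3) = 1 ↔ False) by decide, show ((0:Fin 3) = 2 ↔ False) by decide,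
    show ((1:Fin 3) = 0 ↔ False) by decide, show ((1:Fin 3) = 2 ↔ False) by decide, show ((2:Fin 3) = 0 ↔ False) by decide,
    show ((2:Fin 3) = 1 ↔ False) by decide, if_false]
  rw [hL'] at hL ⊢
  field_simp
  ring

/-- The complexified test vector is transversal: `Σ_i ℓ_i z_i = 0`. [this sketch] -/
theorem sum_mul_complexify_transVec {ℓ : Fin 3 → ℤ} (hℓ : ℓ ≠ 0) (j : Fin 3) :
    ∑ i, (ℓ i : ℂ) * FunctionSpaces.EuclideanSpace.complexify (transVec ℓ j) i = 0 := by
  simp only [FunctionSpaces.EuclideanSpace.complexify_apply]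
  have h := sum_mul_transVec hℓ j
  have : ∑ i, (ℓ i : ℂ) * ((transVec ℓ j i : ℝ) : ℂ) = ((∑ i, (ℓ i : ℝ) * transVec ℓ j i : ℝ) : ℂ) := by push_cast; rfl
  rw [this, h]; simp

theorem sum_mul_I_smul {ℓ : Fin 3 → ℤ} {z : EuclideanSpace ℂ (Fin 3)} (hz : ∑ i, (ℓ i : ℂ) * z i = 0) :
    ∑ i, (ℓ i : ℂ) * (Complex.I • z) i = 0 := by
  simp only [PiLp.smul_apply, smul_eq_mul]
  have : ∑ i, (ℓ i : ℂ) * (Complex.I * z i) = Complex.I * ∑ i, (ℓ i : ℂ) * z i := by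
    rw [Finset.mul_sum]; exact Finset.sum_congr rfl fun i _ => by ring
  rw [this, hz, mul_zero]

/-- For a transversal `v` (`ℓ · v = 0`): `⟪v, q_jℂ⟫ = conj (v j)`. [this sketch] -/
theorem inner_complexify_transVec {ℓ : Fin 3 → ℤ} (hℓ : ℓ ≠ 0) {v : EuclideanSpace ℂ (Fin 3)}
    (hv : ∑ i, (ℓ i : ℂ) * v i = 0) (j : Fin 3) :
    ⟪v, FunctionSpaces.EuclideanSpace.complexify (transVec ℓ j)⟫_ℂ = starRingEnd ℂ (v j) := by
  have hL : (‖Torus.latticeVec ℓ‖ ^ 2 : ℂ) ≠ 0 := by exact_mod_cast pow_ne_zero 2 (norm_latticeVec_pos hℓ).ne'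
  simp only [PiLp.inner_apply, RCLike.inner_apply, FunctionSpaces.EuclideanSpace.complexify_apply, transVec_apply,
    Complex.ofReal_sub, apply_ite Complex.ofReal, Complex.ofReal_one, Complex.ofReal_zero, Complex.ofReal_div,
    Complex.ofReal_mul, Complex.ofReal_intCast, Complex.ofReal_pow]
  simp only [sub_mul, Finset.sum_sub_distrib, ite_mul, one_mul, zero_mul, Finset.sum_ite_eq', Finset.mem_univ, if_true]
  have e : ∑ i, (ℓ j : ℂ) * (ℓ i : ℂ) / (‖Torus.latticeVec ℓ‖ : ℂ) ^ 2 * starRingEnd ℂ (v i) =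
      (ℓ j : ℂ) / (‖Torus.latticeVec ℓ‖ : ℂ) ^ 2 * starRingEnd ℂ (∑ i, (ℓ i : ℂ) * v i) := by
    rw [map_sum, Finset.mul_sum]
    refine Finset.sum_congr rfl fun i _ => ?_
    rw [map_mul, map_intCast]
    field_simp
  rw [e, hv, map_zero, mul_zero, sub_zero]

/-- `(Re w)² + (Re (I w))² = ‖w‖²`. [folklore] -/
theorem re_sq_add_re_I_mul_sq (w : ℂ) : w.re ^ 2 + (Complex.I * w).re ^ 2 = ‖w‖ ^ 2 := by
  rw [Complex.I_mul_re, Complex.sq_norm, Complex.normSq_apply]; ring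

/-- **Sector pairing with a Young parameter.** If `F ∈ L²` has no modes at `±ℓ` and `g ∈ L²` has Fourier support in the
pair-sector `Σ(ℓ)`, then for every `α > 0`, `|∫⟪F, g⟫| ≤ α/2 · ‖P_{Σ(ℓ)}F‖² + (∫‖g‖² − ‖ĝ(ℓ)‖² − ‖ĝ(−ℓ)‖²)/(2α)` (Parseval
`hasSum_re_inner_mFourierCoeff_complexify`, termwise Young, and the two support conditions). [cite: Grafakos2014, Prop. 3.2.7 (3)] -/
theorem abs_integral_inner_le_young_sector {n : ℕ} {ℓ : Fin 3 → ℤ} (hℓ : ℓ ≠ 0) {F g : VF}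
    (hF2 : MemLp F 2 volume) (hg2 : MemLp g 2 volume)
    (hFℓ : ∀ k', k' = ℓ ∨ k' = -ℓ → mFourierCoeff (FunctionSpaces.EuclideanSpace.complexify ∘ F) k' = 0)
    (hg : ∀ k', ¬ ((∀ i, (n:ℤ) ∣ k' i - ℓ i) ∨ (∀ i, (n:ℤ) ∣ k' i + ℓ i)) →
      mFourierCoeff (FunctionSpaces.EuclideanSpace.complexify ∘ g) k' = 0)
    {D : ℝ} (hD : (∫ x, ‖g x‖ ^ 2) - (‖mFourierCoeff (FunctionSpaces.EuclideanSpace.complexify ∘ g) ℓ‖ ^ 2 +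
      ‖mFourierCoeff (FunctionSpaces.EuclideanSpace.complexify ∘ g) (-ℓ)‖ ^ 2) ≤ D)
    {α : ℝ} (hα : 0 < α) :
    |∫ x, ⟪F x, g x⟫_ℝ| ≤ α / 2 * pairSectorEnergy n ℓ F + D / (2 * α) := by
  classical
  set Fh := mFourierCoeff (FunctionSpaces.EuclideanSpace.complexify ∘ F) with hFh
  set gh := mFourierCoeff (FunctionSpaces.EuclideanSpace.complexify ∘ g) with hgh
  have hFi : Integrable F volume := hF2.integrable one_le_two
  have hPF : HasSum (fun k => ‖Fh k‖ ^ 2) (∫ x, ‖F x‖ ^ 2) :=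
    FunctionSpaces.Torus.hasSum_sq_norm_mFourierCoeff_complexify hF2
  have hPg : HasSum (fun k => ‖gh k‖ ^ 2) (∫ x, ‖g x‖ ^ 2) :=
    FunctionSpaces.Torus.hasSum_sq_norm_mFourierCoeff_complexify hg2
  have hpair : HasSum (fun k => (⟪Fh k, gh k⟫_ℂ).re) (∫ x, ⟪F x, g x⟫_ℝ) :=
    FunctionSpaces.Torus.hasSum_re_inner_mFourierCoeff_complexify hF2 hg2
  set S : Set (Fin 3 → ℤ) := PairSector n ℓ with hS
  set E : Finset (Fin 3 → ℤ) := {ℓ, -ℓ} with hE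
  set maj : (Fin 3 → ℤ) → ℝ := fun k => α / 2 * S.indicator (fun k => ‖Fh k‖ ^ 2) k +
    (2 * α)⁻¹ * ((E : Set (Fin 3 → ℤ))ᶜ).indicator (fun k => ‖gh k‖ ^ 2) k with hmaj
  have hs1 : Summable fun k => α / 2 * S.indicator (fun k => ‖Fh k‖ ^ 2) k := (hPF.summable.indicator _).mul_left _
  have hs2 : Summable fun k => (2 * α)⁻¹ * ((E : Set (Fin 3 → ℤ))ᶜ).indicator (fun k => ‖gh k‖ ^ 2) k :=
    (hPg.summable.indicator _).mul_left _
  have hmaj_s : Summable maj := hs1.add hs2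
  -- pointwise domination
  have hdom : ∀ k, |(⟪Fh k, gh k⟫_ℂ).re| ≤ maj k := by
    intro k
    have hi1 : 0 ≤ S.indicator (fun k => ‖Fh k‖ ^ 2) k := Set.indicator_nonneg (fun _ _ => by positivity) _
    have hi2 : 0 ≤ ((E : Set (Fin 3 → ℤ))ᶜ).indicator (fun k => ‖gh k‖ ^ 2) k :=
      Set.indicator_nonneg (fun _ _ => by positivity) _
    have hmaj0 : 0 ≤ maj k := by simp only [hmaj]; positivity
    by_cases hkS : k ∈ S
    · by_cases hkE : k ∈ E
      · have hk' : k = ℓ ∨ k = -ℓ := by simpa [hE] using hkE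
        have : Fh k = 0 := hFℓ k hk'
        rw [this, inner_zero_left, Complex.zero_re, abs_zero]; exact hmaj0
      · have hkE' : k ∈ ((E : Set (Fin 3 → ℤ))ᶜ) := by rwa [Set.mem_compl_iff, Finset.mem_coe]
        simp only [hmaj, Set.indicator_of_mem hkS, Set.indicator_of_mem hkE']
        calc |(⟪Fh k, gh k⟫_ℂ).re| ≤ ‖⟪Fh k, gh k⟫_ℂ‖ := Complex.abs_re_le_norm _
          _ ≤ ‖Fh k‖ * ‖gh k‖ := norm_inner_le_norm _ _
          _ ≤ α / 2 * ‖Fh k‖ ^ 2 + ‖gh k‖ ^ 2 / (2 * α) := mul_le_young hα _ _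
          _ = α / 2 * ‖Fh k‖ ^ 2 + (2 * α)⁻¹ * ‖gh k‖ ^ 2 := by ring
    · have : gh k = 0 := hg k hkS
      rw [this, inner_zero_right, Complex.zero_re, abs_zero]; exact hmaj0
  have habs_s : Summable fun k => ‖(⟪Fh k, gh k⟫_ℂ).re‖ :=
    Summable.of_nonneg_of_le (fun _ => norm_nonneg _) (fun k => by rw [Real.norm_eq_abs]; exact hdom k) hmaj_s
  -- the two partial sums
  have hsumF : ∑' k, S.indicator (fun k => ‖Fh k‖ ^ 2) k = pairSectorEnergy n ℓ F := by
    rw [← tsum_subtype, pairSectorEnergy]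
    exact tsum_congr fun k => (sectorEnergy_eq hFi _).symm
  have hne : ℓ ≠ -ℓ := by
    intro h'
    apply hℓ
    funext i
    have := congr_fun h' i
    simp only [Pi.neg_apply] at this
    show ℓ i = 0
    omega
  have hsumg : ∑' k, ((E : Set (Fin 3 → ℤ))ᶜ).indicator (fun k => ‖gh k‖ ^ 2) k =
      (∫ x, ‖g x‖ ^ 2) - (‖gh ℓ‖ ^ 2 + ‖gh (-ℓ)‖ ^ 2) := by
    rw [← tsum_subtype]
    have h := hPg.summable.sum_add_tsum_compl (s := E)
    rw [hPg.tsum_eq, hE, Finset.sum_pair hne] at h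
    rw [hE]
    linarith
  -- sum up
  rw [← hpair.tsum_eq]
  calc |∑' k, (⟪Fh k, gh k⟫_ℂ).re| = ‖∑' k, (⟪Fh k, gh k⟫_ℂ).re‖ := (Real.norm_eq_abs _).symm
    _ ≤ ∑' k, ‖(⟪Fh k, gh k⟫_ℂ).re‖ := norm_tsum_le_tsum_norm habs_s
    _ ≤ ∑' k, maj k := Summable.tsum_le_tsum (fun k => by rw [Real.norm_eq_abs]; exact hdom k) habs_s hmaj_s
    _ = α / 2 * pairSectorEnergy n ℓ F + (2 * α)⁻¹ * ((∫ x, ‖g x‖ ^ 2) - (‖gh ℓ‖ ^ 2 + ‖gh (-ℓ)‖ ^ 2)) := by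
        simp only [hmaj]
        rw [hs1.tsum_add hs2, tsum_mul_left, tsum_mul_left, hsumF, hsumg]
    _ ≤ α / 2 * pairSectorEnergy n ℓ F + D / (2 * α) := by
        have : (2 * α)⁻¹ * ((∫ x, ‖g x‖ ^ 2) - (‖gh ℓ‖ ^ 2 + ‖gh (-ℓ)‖ ^ 2)) ≤ (2 * α)⁻¹ * D :=
          mul_le_mul_of_nonneg_left hD (by positivity)
        have e : (2 * α)⁻¹ * D = D / (2 * α) := by rw [inv_mul_eq_div]
        linarith

theorem ne_neg_of_ne_zero {ℓ : Fin 3 → ℤ} (hℓ : ℓ ≠ 0) : ℓ ≠ -ℓ := by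
  intro h'
  apply hℓ
  funext i
  have := congr_fun h' i
  simp only [Pi.neg_apply] at this
  show ℓ i = 0
  omega

/-- Exact `L²` norm of a single real mode: `∫‖Re(e_ℓ • z)‖² = ‖z‖²/2` for `ℓ ≠ 0` (Parseval; the coefficients are `z/2`
at `ℓ` and `z̄/2` at `−ℓ`). [cite: Grafakos2014, Prop. 3.2.7 (3)] -/
theorem integral_norm_sq_realTrigPoly_singleton {ℓ : Fin 3 → ℤ} (hℓ : ℓ ≠ 0) (z : EuclideanSpace ℂ (Fin 3)) :
    ∫ x, ‖FunctionSpaces.Torus.realTrigPoly {ℓ} (fun _ => z) x‖ ^ 2 = ‖z‖ ^ 2 / 2 := by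
  classical
  have hne := ne_neg_of_ne_zero hℓ
  rw [FunctionSpaces.Torus.integral_norm_sq_eq_tsum (FunctionSpaces.Torus.memLp_realTrigPoly _ _ 2)]
  have hcoef : ∀ k', ‖mFourierCoeff (FunctionSpaces.EuclideanSpace.complexify ∘
      FunctionSpaces.Torus.realTrigPoly {ℓ} (fun _ => z)) k'‖ ^ 2 =
      if k' = ℓ ∨ k' = -ℓ then ‖z‖ ^ 2 / 4 else 0 := by
    intro k'
    rw [FunctionSpaces.Torus.mFourierCoeff_realTrigPoly_singleton]
    by_cases h1 : k' = ℓ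
    · have h2 : k' ≠ -ℓ := by rw [h1]; exact hne
      rw [if_pos h1, if_neg h2, if_pos (Or.inl h1), EuclideanSpace.conjVec_zero, add_zero, norm_smul, mul_pow,
        norm_inv, Complex.norm_ofNat]
      ring
    · by_cases h2 : k' = -ℓ
      · rw [if_neg h1, if_pos h2, if_pos (Or.inr h2), zero_add, norm_smul, EuclideanSpace.norm_conjVec, mul_pow,
          norm_inv, Complex.norm_ofNat]
        ring
      · rw [if_neg h1, if_neg h2, if_neg (by tauto), EuclideanSpace.conjVec_zero, add_zero, smul_zero, norm_zero]
        ring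
  simp_rw [hcoef]
  rw [tsum_eq_sum (s := ({ℓ, -ℓ} : Finset (Fin 3 → ℤ)))
      (fun k' hk' => if_neg (by rwa [Finset.mem_insert, Finset.mem_singleton] at hk')),
    Finset.sum_pair hne, if_pos (Or.inl rfl), if_pos (Or.inr rfl)]
  ring

/-- **`SlowModeBound` from D1–D3 and `CarrierFastContent` (PROVED conditional).**  Per transversal test vector `z`
(`ℓ · z = 0`): Lions adjoint solution `ψ` from `Re(e_ℓ • z)` (`exists_adjoint`), sector support of `ψ̂(r)`
(`ae_mFourierCoeff_eq_zero_off_sector` along the grid-periodic reversed carrier), fast content of `ψ(r)`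
(`CarrierFastContent`), Parseval pairing with a Young parameter (`abs_integral_inner_le_young_sector`), `DualityBound`;
then `sq_le_mul_of_young`, the tests `z = q_jℂ` and `I • q_jℂ` (`transVec`), transversality of `û(t₀)(ℓ)`
(`IsWeaklyDivFree.sum_mul_mFourierCoeff_eq_zero`) and `Σ_j ‖q_j‖² = 2`. [this sketch] -/
theorem slowModeBound_core (hDual : DualityBound) (hCF : CarrierFastContent) : SlowModeBound := by
  intro k W M hM lo hi lam hlo hlam ν hν n hn 𝔸 hA F hF hF0 T u hu ℓ hℓ hℓn
  rcases le_or_gt T 0 with hT | hT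
  · have h0 : volume.restrict (Ioo (0:ℝ) T) = 0 := by rw [Ioo_eq_empty (not_lt.2 hT), Measure.restrict_empty]
    rw [h0]; simp
  have hn' : (0:ℝ) < n := by exact_mod_cast hn
  have hlam0 : 0 < lam := one_pos.trans_le hlam
  have hN : Torus.NearIso ((1 / (n:ℝ) ^ 2) • 𝔸) ((1 / (n:ℝ) ^ 2) * (ν * (lo / lam))) ((1 / (n:ℝ) ^ 2) * (ν * (hi * lam))) :=
    hA.smul (by positivity)
  have hlo' : 0 < (1 / (n:ℝ) ^ 2) * (ν * (lo / lam)) := by positivity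
  have hNt := (Torus.nearIso_majorTranspose_iff _ _ _).2 hN
  have hbT : MemLp (FunctionSpaces.Torus.stLift (cellField W M hM ν hν n)) ∞
      (volume.restrict (Ioo 0 T ×ˢ (univ : Set (EuclideanSpace ℝ (Fin 3))))) := memLp_top_stLift_cell _ n T
  have hF2 : MemLp F 2 volume := memLp_two_of_memSobolev_one_complexify hF.1
  have hFi : Integrable F volume := hF2.integrable one_le_two
  have hFℓ : ∀ k', k' = ℓ ∨ k' = -ℓ → mFourierCoeff (FunctionSpaces.EuclideanSpace.complexify ∘ F) k' = 0 := by
    intro k' hk'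
    have hk'n : ‖Torus.latticeVec k'‖ < (n:ℝ) / 2 := by
      rcases hk' with rfl | rfl
      · linarith
      · rw [Torus.latticeVec_neg, norm_neg]; linarith
    ext i
    rw [PiLp.zero_apply, ← modeCoeff_eq hFi]
    exact hF0 k' hk'n i
  have hℓi : ∀ i, 2 * |(ℓ i : ℝ)| ≤ n := fun i => by
    have := abs_coord_le_norm_latticeVec ℓ i; linarith
  set P := pairSectorEnergy n ℓ F with hP_def
  have hP0 : 0 ≤ P := pairSectorEnergy_nonneg _ _ _
  set D₀ : ℝ := 9 * (k:ℝ) ^ 2 * lam ^ 2 * ‖Torus.latticeVec ℓ‖ ^ 2 / (Real.pi ^ 4 * (n:ℝ) ^ 2 * ν ^ 2 * lo ^ 2)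
    with hD₀_def
  have hD₀0 : 0 ≤ D₀ := by positivity
  have hconst : ∀ E : ℝ, (3 * ((k:ℝ) / (2 * Real.pi * n)) * (2 * Real.pi * ‖Torus.latticeVec ℓ‖)) ^ 2 * E /
      (4 * Real.pi ^ 2 * ((1 / (n:ℝ) ^ 2) * (ν * (lo / lam))) * ((n:ℝ) ^ 2 / 4)) ^ 2 = D₀ * E := by
    intro E; rw [hD₀_def]; field_simp; ring
  -- KEY: the duality estimate for one transversal test vector `z`
  have key : ∀ z : EuclideanSpace ℂ (Fin 3), (∑ j, (ℓ j : ℂ) * z j = 0) →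
      ∀ᵐ t₀ ∂(volume.restrict (Ioo 0 T)),
        (∫ x, ⟪u t₀ x, FunctionSpaces.Torus.realTrigPoly {ℓ} (fun _ => z) x⟫_ℝ) ^ 2 ≤ P * (D₀ * (‖z‖ ^ 2 / 2)) := by
    intro z hz
    have hφ2 : MemLp (FunctionSpaces.Torus.realTrigPoly {ℓ} (fun _ => z)) 2 volume :=
      FunctionSpaces.Torus.memLp_realTrigPoly _ _ _
    have hφdiv : FunctionSpaces.Torus.IsWeaklyDivFree (FunctionSpaces.Torus.realTrigPoly {ℓ} (fun _ => z)) :=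
      (FunctionSpaces.Torus.isDivFree_realTrigPoly_singleton hz).isWeaklyDivFree_holds
        (FunctionSpaces.Torus.isSmooth_realTrigPoly _ _)
    have hφsupp : ∀ k', k' ≠ ℓ → k' ≠ -ℓ →
        mFourierCoeff (FunctionSpaces.EuclideanSpace.complexify ∘ FunctionSpaces.Torus.realTrigPoly {ℓ} (fun _ => z)) k' = 0 := by
      intro k' h1' h2'
      rw [FunctionSpaces.Torus.mFourierCoeff_realTrigPoly_singleton]
      simp [h1', h2']
    have hφsupp' : ∀ k', mFourierCoeff (FunctionSpaces.EuclideanSpace.complexify ∘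
        FunctionSpaces.Torus.realTrigPoly {ℓ} (fun _ => z)) k' ≠ 0 →
        (∀ i, (n:ℤ) ∣ k' i - ℓ i) ∨ (∀ i, (n:ℤ) ∣ k' i + ℓ i) := by
      intro k' hk'
      by_cases h1' : k' = ℓ
      · left; intro i; rw [h1', sub_self]; exact dvd_zero _
      by_cases h2' : k' = -ℓ
      · right; intro i; rw [h2', Pi.neg_apply, neg_add_cancel]; exact dvd_zero _
      exact absurd (hφsupp k' h1' h2') hk'
    have hφE : ∫ x, ‖FunctionSpaces.Torus.realTrigPoly {ℓ} (fun _ => z) x‖ ^ 2 = ‖z‖ ^ 2 / 2 :=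
      integral_norm_sq_realTrigPoly_singleton hℓ z
    filter_upwards [hDual T _ _ _ hN hlo' _ hbT F u hF2 hF.2.2 hu _ hφ2 hφdiv,
      ae_restrict_mem measurableSet_Ioo] with t₀ ht₀ ht₀mem
    obtain ⟨ψ, hψ⟩ := exists_adjoint W M hM hlo hlam0 hν hn hA hu ⟨ht₀mem.1, ht₀mem.2.le⟩ hφ2 hφdiv
    have hbrev := memLp_top_stLift_revCarrier_cellField W M hM hν n t₀ t₀
    have hsect := hψ.ae_mFourierCoeff_eq_zero_off_sector hn ℓ hNt hlo' hbrev
      (fun j r x => revCarrier_cellField_add_grid W M hM hν hn j t₀ r x) hφ2 hφsupp'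
    have hfast := hCF k n hn _ t₀ hbrev (fun s x => norm_revCarrier_cellField_le W M hM hν hn t₀ s x)
      (fun j s x => revCarrier_cellField_add_grid W M hM hν hn j t₀ s x) _ _ _ hNt hlo' ℓ hℓ hℓi _ hφ2 hφdiv hφsupp ψ hψ
    have hY : ∀ α : ℝ, 0 < α →
        |∫ x, ⟪u t₀ x, FunctionSpaces.Torus.realTrigPoly {ℓ} (fun _ => z) x⟫_ℝ| ≤
          α / 2 * P + D₀ * (‖z‖ ^ 2 / 2) / (2 * α) := by
      intro α hα
      refine ht₀ ψ hbrev hψ _ ?_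
      filter_upwards [hsect, hfast, hψ.ae_memLp_two] with r hr_sect hr_fast hr2
      refine abs_integral_inner_le_young_sector hℓ hF2 hr2 hFℓ hr_sect ?_ hα
      rw [hconst, hφE] at hr_fast
      exact hr_fast
    exact sq_le_mul_of_young hP0 (by positivity) hY
  -- combine the tests `q_jℂ` and `I • q_jℂ`
  have hall : ∀ᵐ t₀ ∂(volume.restrict (Ioo 0 T)), ∀ j : Fin 3,
      (∫ x, ⟪u t₀ x, FunctionSpaces.Torus.realTrigPoly {ℓ}
          (fun _ => FunctionSpaces.EuclideanSpace.complexify (transVec ℓ j)) x⟫_ℝ) ^ 2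
          ≤ P * (D₀ * (‖FunctionSpaces.EuclideanSpace.complexify (transVec ℓ j)‖ ^ 2 / 2)) ∧
      (∫ x, ⟪u t₀ x, FunctionSpaces.Torus.realTrigPoly {ℓ}
          (fun _ => Complex.I • FunctionSpaces.EuclideanSpace.complexify (transVec ℓ j)) x⟫_ℝ) ^ 2
          ≤ P * (D₀ * (‖Complex.I • FunctionSpaces.EuclideanSpace.complexify (transVec ℓ j)‖ ^ 2 / 2)) := by
    refine ae_all_iff.2 fun j => ?_
    filter_upwards [key _ (sum_mul_complexify_transVec hℓ j),
      key _ (sum_mul_I_smul (sum_mul_complexify_transVec hℓ j))] with t₀ h1' h2'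
    exact ⟨h1', h2'⟩
  filter_upwards [hall, hu.ae_memLp_two, hu.ae_isWeaklyDivFree] with t₀ ht hut2 hutdiv
  have huti : Integrable (u t₀) volume := hut2.integrable one_le_two
  have hvtr : ∑ i, (ℓ i : ℂ) * mFourierCoeff (FunctionSpaces.EuclideanSpace.complexify ∘ u t₀) ℓ i = 0 :=
    hutdiv.sum_mul_mFourierCoeff_eq_zero hut2 ℓ
  have hj : ∀ j : Fin 3, ‖mFourierCoeff (FunctionSpaces.EuclideanSpace.complexify ∘ u t₀) ℓ j‖ ^ 2 ≤
      P * D₀ * ‖transVec ℓ j‖ ^ 2 := by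
    intro j
    obtain ⟨hj1, hj2⟩ := ht j
    rw [FunctionSpaces.Torus.integral_inner_realTrigPoly_singleton huti] at hj1 hj2
    rw [inner_smul_right, norm_smul, Complex.norm_I, one_mul] at hj2
    rw [FunctionSpaces.EuclideanSpace.norm_complexify, inner_complexify_transVec hℓ hvtr j] at hj1 hj2
    have e := re_sq_add_re_I_mul_sq (starRingEnd ℂ (mFourierCoeff (FunctionSpaces.EuclideanSpace.complexify ∘ u t₀) ℓ j))
    rw [RCLike.norm_conj] at e
    linarith
  have hse : sectorEnergy ℓ (u t₀) = ∑ j, ‖mFourierCoeff (FunctionSpaces.EuclideanSpace.complexify ∘ u t₀) ℓ j‖ ^ 2 := by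
    rw [sectorEnergy_eq huti, EuclideanSpace.norm_sq_eq]
  rw [hse]
  calc ∑ j, ‖mFourierCoeff (FunctionSpaces.EuclideanSpace.complexify ∘ u t₀) ℓ j‖ ^ 2
      ≤ ∑ j, P * D₀ * ‖transVec ℓ j‖ ^ 2 := Finset.sum_le_sum fun j _ => hj j
    _ = P * D₀ * ∑ j, ‖transVec ℓ j‖ ^ 2 := by rw [Finset.mul_sum]
    _ = 18 * (k:ℝ) ^ 2 * lam ^ 2 * ‖Torus.latticeVec ℓ‖ ^ 2 / (Real.pi ^ 4 * (n:ℝ) ^ 2 * ν ^ 2 * lo ^ 2) * P := by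
        rw [sum_norm_sq_transVec hℓ, hD₀_def]; ring

/-- `SlowModeBound` from D1–D3 (the §2 shapes) and `CarrierFastContent` (v4 name and type). [this sketch] -/
theorem slowModeBound_of (h1 : PairingConst) (h2 : InitialTrace) (h3 : ContinuousRepr) (hCF : CarrierFastContent) :
    SlowModeBound :=
  slowModeBound_core (dualityBound_of h1 h2 h3) hCF

/-- **Net result of this workfile (v4): the v21 registered stub `stub_cellEnergyT` — statement verbatim — from the three
Literature-level duality texts D1–D3 and the tree-internal `CarrierFastContent`.**  By-name composition
`cellEnergyT_of_slowModeBound ∘ slowModeBound_of`. [this sketch] -/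
theorem cellEnergyT_of_D123_CF (h1 : PairingConst) (h2 : InitialTrace) (h3 : ContinuousRepr) (hCF : CarrierFastContent) :
    ∀ k (W : Literature.Analysis.FluidPDE.LatticeShear.LatticeWord k) (M : ℝ) (hM : 0 < M) (c : ℝ), 0 < c →
    ∀ lo hi Λ β : ℝ, 0 < lo → lo ≤ 1 → 1 ≤ hi → 1 < Λ → 0 ≤ β →
      ∃ C : ℝ, 0 ≤ C ∧ ∃ ν₀ > (0:ℝ), ∃ K > (0:ℝ), CellEnergyClausesNoE W M hM c lo hi Λ β C ν₀ K :=
  cellEnergyT_of_slowModeBound (slowModeBound_of h1 h2 h3 hCF)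

/-! ## §7 (v5) Discharging D2, D3 and `CarrierFastContent` BY NAME from the tree — the v21 stub from D1 alone

ad-lit g25 landed (p638640, `Literature/Analysis/FluidPDE/PassiveVectorTensorWeakContinuity.lean`) the strong initial trace
`forall_eps_ae_integral_norm_sq_sub_le_of_nearIso` (= D2 `InitialTrace` by name) and the continuous representative of the pairing
with an `L²` WEAKLY DIVERGENCE-FREE test `exists_continuousOn_integral_inner` (continuous on `Icc 0 T`, value `⟪w₀, φ⟫` at `0`).  The §2
text `ContinuousRepr` asked for ALL `L²` tests; the assembly only ever uses the div-free test `φ` of `DualityBound`, so we record the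
div-free shape `ContinuousReprDF` (implied by both), prove it by name, and re-run the §2 assembly through it (`dualityBound_core`; the §2
texts and `dualityBound_of` are untouched).  ad-k3l-bookkeeping-p1 g3 landed the body of `CarrierFastContent` (p639358
`ae_complement_pair_energy_le`) and of `MeanConservation` (p638532 `ae_modeCoeff_zero_eq`).  Net: `cellEnergyT_of_D1 : PairingConst → <v21
stub_cellEnergyT text verbatim>` — D1 is the last input. -/

/-- **D3, div-free-test shape** (what the assembly uses; implied by `ContinuousRepr` and by the landed
`exists_continuousOn_integral_inner`). [cite: Evans2010, §7.1.2 Thm. 3] -/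
def ContinuousReprDF : Prop :=
  ∀ (T : ℝ) (𝔹 : Torus.Visc4 (Fin 3)) (lo hi : ℝ), Torus.NearIso 𝔹 lo hi → 0 < lo →
  ∀ (b : ℝ → VF), MemLp (FunctionSpaces.Torus.stLift b) ∞ (volume.restrict (Ioo 0 T ×ˢ (univ : Set (EuclideanSpace ℝ (Fin 3))))) →
  ∀ (w₀ : VF) (w : ℝ → VF), MemLp w₀ 2 volume → FunctionSpaces.Torus.IsWeaklyDivFree w₀ →
    Torus.IsWeakTensorPassiveVectorOn 0 T 𝔹 b w₀ w →
  ∀ φ : VF, MemLp φ 2 volume → FunctionSpaces.Torus.IsWeaklyDivFree φ →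
    ∃ G : ℝ → ℝ, ContinuousOn G (Ioo 0 T) ∧ ∀ᵐ t ∂(volume.restrict (Ioo 0 T)), ∫ x, ⟪w t x, φ x⟫_ℝ = G t

theorem continuousReprDF_of (h3 : ContinuousRepr) : ContinuousReprDF :=
  fun T 𝔹 lo hi hN hlo b hb w₀ w hw₀ hdiv hsol φ hφ2 _ => h3 T 𝔹 lo hi hN hlo b hb w₀ w hw₀ hdiv hsol φ hφ2

/-- D3 (div-free-test shape) BY NAME from the tree (ad-lit g25, p638640). -/
theorem continuousReprDF : ContinuousReprDF := by
  intro T 𝔹 lo hi _ _ b _ w₀ w hw₀ _ hsol φ hφ2 hφdiv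
  obtain ⟨g, hgc, -, hae⟩ := hsol.exists_continuousOn_integral_inner hw₀ hφ2 hφdiv
  exact ⟨g, hgc.mono Ioo_subset_Icc_self, hae⟩

/-- D2 BY NAME from the tree (ad-lit g25, p638640). -/
theorem initialTrace : InitialTrace := by
  intro T 𝔹 lo hi hN hlo b hb w₀ w hw₀ hdiv hsol
  exact hsol.forall_eps_ae_integral_norm_sq_sub_le_of_nearIso hN hlo hw₀ hdiv hb

/-- `CarrierFastContent` BY NAME from the tree (ad-k3l-bookkeeping-p1 g3, p639358). -/
theorem carrierFastContent : CarrierFastContent := ae_complement_pair_energy_le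

/-- `MeanConservation` is ALSO in the tree by name (p638532); recorded for the port. -/
theorem meanConservation_tree : MeanConservation := ae_modeCoeff_zero_eq

/-- **The §2 assembly re-run through the div-free-test shape of D3** (proof = `dualityBound_of` verbatim, `h3` fed `hφdiv`). -/
theorem dualityBound_core (h1 : PairingConst) (h2 : InitialTrace) (h3 : ContinuousReprDF) : DualityBound := by
  intro T 𝔹 lo hi hN hlo b hb F u hF2 hFdiv hu φ hφ2 hφdiv
  obtain ⟨G, hGc, hGae⟩ := h3 T 𝔹 lo hi hN hlo b hb F u hF2 hFdiv hu φ hφ2 hφdiv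
  have hEF0 : 0 ≤ ∫ x, ‖F x‖ ^ 2 := integral_nonneg fun _ => by positivity
  have hEφ0 : 0 ≤ ∫ x, ‖φ x‖ ^ 2 := integral_nonneg fun _ => by positivity
  -- energy bound and slice `L²` membership for `u`
  have hEu : ∀ᵐ s ∂(volume.restrict (Ioo 0 T)), ∫ x, ‖u s x‖ ^ 2 ≤ ∫ x, ‖F x‖ ^ 2 := by
    filter_upwards [hu.ae_energy_ineq hN hlo hF2 hFdiv hb] with s hs
    exact (ENNReal.ofReal_le_ofReal_iff hEF0).1 (le_trans le_self_add hs)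
  have hu2 := hu.ae_memLp_two
  filter_upwards [hGae, ae_restrict_mem measurableSet_Ioo] with t₀ hG₀ ht₀
  intro ψ hbrev hψ B hB
  have hN' : Torus.NearIso (Torus.majorTranspose 𝔹) lo hi := (Torus.nearIso_majorTranspose_iff 𝔹 lo hi).2 hN
  obtain ⟨c, hc⟩ := h1 T 𝔹 lo hi hN hlo b hb F u hF2 hFdiv hu t₀ ⟨ht₀.1, ht₀.2.le⟩ φ ψ hφ2 hφdiv hbrev hψ
  have hEψ : ∀ᵐ r ∂(volume.restrict (Ioo 0 t₀)), ∫ x, ‖ψ r x‖ ^ 2 ≤ ∫ x, ‖φ x‖ ^ 2 := by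
    filter_upwards [hψ.ae_energy_ineq hN' hlo hφ2 hφdiv hbrev] with r hr
    exact (ENNReal.ofReal_le_ofReal_iff hEφ0).1 (le_trans le_self_add hr)
  have hψ2 := hψ.ae_memLp_two
  have hsub : Ioo 0 t₀ ⊆ Ioo 0 T := Ioo_subset_Ioo_right ht₀.2.le
  -- ### Step A: `|c| ≤ B` (look near `s = 0`)
  have hA : |c| ≤ B := by
    refine le_of_forall_pos_le_add fun κ hκ => ?_
    obtain ⟨δ, hδ, hδu⟩ := h2 T 𝔹 lo hi hN hlo b hb F u hF2 hFdiv hu (κ * (κ / ((∫ x, ‖φ x‖ ^ 2) + 1))) (by positivity)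
    have hall : ∀ᵐ s ∂(volume.restrict (Ioo 0 t₀)),
        (∫ x, ⟪u s x, ψ (t₀ - s) x⟫_ℝ = c) ∧
        (s < δ → ∫ x, ‖u s x - F x‖ ^ 2 ≤ κ * (κ / ((∫ x, ‖φ x‖ ^ 2) + 1))) ∧
        (∫ x, ‖ψ (t₀ - s) x‖ ^ 2 ≤ ∫ x, ‖φ x‖ ^ 2) ∧ MemLp (ψ (t₀ - s)) 2 volume ∧
        |∫ x, ⟪F x, ψ (t₀ - s) x⟫_ℝ| ≤ B ∧ MemLp (u s) 2 volume := by
      filter_upwards [hc, ae_restrict_of_ae_restrict_of_subset hsub hδu, ae_restrict_Ioo_reflect hEψ,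
        ae_restrict_Ioo_reflect hψ2, ae_restrict_Ioo_reflect hB, ae_restrict_of_ae_restrict_of_subset hsub hu2]
        with s h1' h2' h3' h4' h5' h6'
      exact ⟨h1', h2', h3', h4', h5', h6'⟩
    have hδ'0 : 0 < min δ t₀ := lt_min hδ ht₀.1
    have hsub' : Ioo 0 (min δ t₀) ⊆ Ioo 0 t₀ := Ioo_subset_Ioo_right (min_le_right _ _)
    obtain ⟨s, hsI, hcs, hδs, hEs, hψs, hBs, hus⟩ :=
      exists_of_ae_Ioo hδ'0 (ae_restrict_of_ae_restrict_of_subset hsub' hall)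
    have hsδ : s < δ := lt_of_lt_of_le hsI.2 (min_le_left _ _)
    have hf2 : MemLp (fun x => u s x - F x) 2 volume := hus.sub hF2
    have hsplit : ∫ x, ⟪u s x, ψ (t₀ - s) x⟫_ℝ =
        (∫ x, ⟪F x, ψ (t₀ - s) x⟫_ℝ) + ∫ x, ⟪u s x - F x, ψ (t₀ - s) x⟫_ℝ := by
      rw [← integral_add (integrable_inner₂ hF2 hψs) (integrable_inner₂ hf2 hψs)]
      refine integral_congr_ae (ae_of_all _ fun x => ?_)
      show ⟪u s x, ψ (t₀ - s) x⟫_ℝ = ⟪F x, ψ (t₀ - s) x⟫_ℝ + ⟪u s x - F x, ψ (t₀ - s) x⟫_ℝ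
      rw [inner_sub_left]; ring
    have hsmall := abs_integral_inner_le_of_small hf2 hψs hκ hEφ0 (hδs hsδ) hEs
    calc |c| = |(∫ x, ⟪F x, ψ (t₀ - s) x⟫_ℝ) + ∫ x, ⟪u s x - F x, ψ (t₀ - s) x⟫_ℝ| := by rw [← hsplit, hcs]
      _ ≤ |∫ x, ⟪F x, ψ (t₀ - s) x⟫_ℝ| + |∫ x, ⟪u s x - F x, ψ (t₀ - s) x⟫_ℝ| := abs_add_le _ _
      _ ≤ B + κ := add_le_add hBs hsmall
  -- ### Step B: `G t₀ = c` (look near `s = t₀`)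
  have hB' : G t₀ = c := by
    have key : ∀ κ > (0:ℝ), |G t₀ - c| ≤ 2 * κ := by
      intro κ hκ
      obtain ⟨ρ, hρ, hρG⟩ := Metric.continuousWithinAt_iff.1 (hGc t₀ ht₀) κ hκ
      obtain ⟨δ₂, hδ₂, hδψ⟩ := h2 t₀ (Torus.majorTranspose 𝔹) lo hi hN' hlo (revCarrier b t₀) hbrev φ ψ hφ2 hφdiv hψ
        (κ * (κ / ((∫ x, ‖F x‖ ^ 2) + 1))) (by positivity)
      have hall : ∀ᵐ s ∂(volume.restrict (Ioo 0 t₀)),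
          (∫ x, ⟪u s x, ψ (t₀ - s) x⟫_ℝ = c) ∧
          (t₀ - s < δ₂ → ∫ x, ‖ψ (t₀ - s) x - φ x‖ ^ 2 ≤ κ * (κ / ((∫ x, ‖F x‖ ^ 2) + 1))) ∧
          (∫ x, ‖u s x‖ ^ 2 ≤ ∫ x, ‖F x‖ ^ 2) ∧ MemLp (u s) 2 volume ∧ (∫ x, ⟪u s x, φ x⟫_ℝ = G s) ∧
          MemLp (ψ (t₀ - s)) 2 volume := by
        filter_upwards [hc, ae_restrict_Ioo_reflect hδψ, ae_restrict_of_ae_restrict_of_subset hsub hEu,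
          ae_restrict_of_ae_restrict_of_subset hsub hu2, ae_restrict_of_ae_restrict_of_subset hsub hGae,
          ae_restrict_Ioo_reflect hψ2] with s h1' h2' h3' h4' h5' h6'
        exact ⟨h1', h2', h3', h4', h5', h6'⟩
      have hm1 : min (min δ₂ ρ) t₀ ≤ t₀ := min_le_right _ _
      have hm2 : min (min δ₂ ρ) t₀ ≤ δ₂ := (min_le_left _ _).trans (min_le_left _ _)
      have hm3 : min (min δ₂ ρ) t₀ ≤ ρ := (min_le_left _ _).trans (min_le_right _ _)
      have hδ₃0 : 0 < min (min δ₂ ρ) t₀ := lt_min (lt_min hδ₂ hρ) ht₀.1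
      have hsub' : Ioo (t₀ - min (min δ₂ ρ) t₀) t₀ ⊆ Ioo 0 t₀ := Ioo_subset_Ioo_left (by linarith)
      obtain ⟨s, hsI, hcs, hδs, hEs, hus, hGs, hψs⟩ :=
        exists_of_ae_Ioo (by linarith : t₀ - min (min δ₂ ρ) t₀ < t₀) (ae_restrict_of_ae_restrict_of_subset hsub' hall)
      have hs2 : t₀ - s < δ₂ := by linarith [hsI.1]
      have hsρ : dist s t₀ < ρ := by
        rw [Real.dist_eq, abs_sub_comm, abs_of_pos (by linarith [hsI.2])]
        linarith [hsI.1]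
      have hsT : s ∈ Ioo 0 T := hsub (hsub' hsI)
      have hGκ : dist (G s) (G t₀) < κ := hρG hsT hsρ
      have hg2 : MemLp (fun x => ψ (t₀ - s) x - φ x) 2 volume := hψs.sub hφ2
      have hsplit : ∫ x, ⟪u s x, ψ (t₀ - s) x⟫_ℝ =
          (∫ x, ⟪u s x, φ x⟫_ℝ) + ∫ x, ⟪ψ (t₀ - s) x - φ x, u s x⟫_ℝ := by
        rw [← integral_add (integrable_inner₂ hus hφ2) (integrable_inner₂ hg2 hus)]
        refine integral_congr_ae (ae_of_all _ fun x => ?_)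
        show ⟪u s x, ψ (t₀ - s) x⟫_ℝ = ⟪u s x, φ x⟫_ℝ + ⟪ψ (t₀ - s) x - φ x, u s x⟫_ℝ
        rw [real_inner_comm (u s x) (ψ (t₀ - s) x - φ x), inner_sub_right]; ring
      have hsmall := abs_integral_inner_le_of_small hg2 hus hκ hEF0 (hδs hs2) hEs
      have e1 : c - G s = ∫ x, ⟪ψ (t₀ - s) x - φ x, u s x⟫_ℝ := by rw [← hcs, hsplit, hGs]; ring
      rw [Real.dist_eq] at hGκ
      calc |G t₀ - c| ≤ |G t₀ - G s| + |G s - c| := abs_sub_le _ _ _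
        _ ≤ κ + κ := by
            refine add_le_add ?_ ?_
            · rw [abs_sub_comm]; exact hGκ.le
            · rw [abs_sub_comm, e1]; exact hsmall
        _ = 2 * κ := by ring
    by_contra hne
    have hpos : 0 < |G t₀ - c| := abs_pos.2 (sub_ne_zero.2 hne)
    have := key (|G t₀ - c| / 4) (by positivity)
    linarith
  rw [hG₀, hB']
  exact hA


/-- `DualityBound` from D1 alone (D2, D3 by name). -/
theorem dualityBound_of_D1 (h1 : PairingConst) : DualityBound := dualityBound_core h1 initialTrace continuousReprDF

/-- `SlowModeBound` from D1 alone. -/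
theorem slowModeBound_of_D1 (h1 : PairingConst) : SlowModeBound :=
  slowModeBound_core (dualityBound_of_D1 h1) carrierFastContent

/-- **Net result of this workfile (v5): the v21 registered stub `stub_cellEnergyT` — statement verbatim — from D1 `PairingConst`
ALONE** (D2, D3, `CarrierFastContent`, `SectorCount`, `MeanConservation` discharged in this file or by name from the tree). [this sketch] -/
theorem cellEnergyT_of_D1 (h1 : PairingConst) :
    ∀ k (W : Literature.Analysis.FluidPDE.LatticeShear.LatticeWord k) (M : ℝ) (hM : 0 < M) (c : ℝ), 0 < c →
    ∀ lo hi Λ β : ℝ, 0 < lo → lo ≤ 1 → 1 ≤ hi → 1 < Λ → 0 ≤ β →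
      ∃ C : ℝ, 0 ≤ C ∧ ∃ ν₀ > (0:ℝ), ∃ K > (0:ℝ), CellEnergyClausesNoE W M hM c lo hi Λ β C ν₀ K :=
  cellEnergyT_of_slowModeBound (slowModeBound_of_D1 h1)

/-! ## §8 (v6) The uniform clauses discharge the window-local re-cut (F_T) a fortiori — the K1L_D registry-v2 text of `stub_cellEnergyT`

Tenure D24-5 (14:06Z) re-typed `stub_cellEnergyT` to the window-local conclusion `CellEnergyClausesWNoE` (clause (F_T): the same bound
times `exp (C·(L²/(n²ν))·t)`), closed by the lead's primal `cellEnergyT_W`.  The uniform clauses imply it (`exp ≥ 1`), so the duality line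
gives the v2 text too, from D1 alone. -/

/-- (F) ⇒ (F_T) without the energy conjunct: `CellEnergyClausesNoE → CellEnergyClausesWNoE` for `c, C ≥ 0` (`exp ≥ 1` on `t > 0`). [folklore] -/
theorem cellEnergyClausesWNoE_of_noE {k : ℕ} {W : Literature.Analysis.FluidPDE.LatticeShear.LatticeWord k} {M : ℝ} {hM : 0 < M}
    {c : ℝ} {lo hi Λ β C ν₀ K : ℝ} (hc : 0 ≤ c) (hC : 0 ≤ C) (h : CellEnergyClausesNoE W M hM c lo hi Λ β C ν₀ K) :
    CellEnergyClausesWNoE W M hM c lo hi Λ β C ν₀ K := by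
  intro ν hν n 𝔸 hodd hwin
  obtain ⟨hF, hCc⟩ := h ν hν n 𝔸 hodd hwin
  refine ⟨fun L hL hLn F hFd hmodes T hT u hu => ?_, hCc⟩
  filter_upwards [hF L hL hLn F hFd hmodes T hT u hu, ae_restrict_mem measurableSet_Ioo] with t ht htI
  refine ht.trans ?_
  have hν0 : 0 < ν := hν.1
  have ht0 : 0 < t := htI.1
  have hA : 0 ≤ C * (c * L ^ 2 / ((n:ℝ) ^ 2 * ν ^ 2)) := by positivity
  have hB : 0 ≤ ∫ x, ‖F x‖ ^ 2 := integral_nonneg fun _ => by positivity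
  have hE : 1 ≤ Real.exp (C * (L ^ 2 / ((n:ℝ) ^ 2 * ν)) * t) := Real.one_le_exp (by positivity)
  calc C * (c * L ^ 2 / ((n:ℝ) ^ 2 * ν ^ 2)) * ∫ x, ‖F x‖ ^ 2
      = C * (c * L ^ 2 / ((n:ℝ) ^ 2 * ν ^ 2)) * 1 * ∫ x, ‖F x‖ ^ 2 := by ring
    _ ≤ C * (c * L ^ 2 / ((n:ℝ) ^ 2 * ν ^ 2)) * Real.exp (C * (L ^ 2 / ((n:ℝ) ^ 2 * ν)) * t) * ∫ x, ‖F x‖ ^ 2 := by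
        gcongr

/-- **The K1L_D registry-v2 text of `stub_cellEnergyT` (conclusion `CellEnergyClausesWNoE`) from D1 alone**, a fortiori. [this sketch] -/
theorem cellEnergyT_W_of_D1 (h1 : PairingConst) :
    ∀ k (W : Literature.Analysis.FluidPDE.LatticeShear.LatticeWord k) (M : ℝ) (hM : 0 < M) (c : ℝ), 0 < c →
    ∀ lo hi Λ β : ℝ, 0 < lo → lo ≤ 1 → 1 ≤ hi → 1 < Λ → 0 ≤ β →
      ∃ C : ℝ, 0 ≤ C ∧ ∃ ν₀ > (0:ℝ), ∃ K > (0:ℝ), CellEnergyClausesWNoE W M hM c lo hi Λ β C ν₀ K := by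
  intro k W M hM c hc lo hi Λ β hlo hlo1 hhi hΛ hβ
  obtain ⟨C, hC, ν₀, hν₀, K, hK, h⟩ := cellEnergyT_of_D1 h1 k W M hM c hc lo hi Λ β hlo hlo1 hhi hΛ hβ
  exact ⟨C, hC, ν₀, hν₀, K, hK, cellEnergyClausesWNoE_of_noE hc.le hC h⟩

/-! ## §9 (v7) D1 IS A THEOREM (ad-lit g25, p640160 `PassiveVectorTensorDuality.lean`, 14:14Z) — the chain is UNCONDITIONAL

`PairingConst` (§2, text frozen since v1) is discharged by
`Torus.IsWeakTensorPassiveVectorOn.exists_ae_integral_inner_reversed_eq_const` (the landed theorem takes the reversed carrier as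
`fun r => -b (t₀ - r)`, which is `revCarrier b t₀` by `funext`; it does not need the `L^∞` hypothesis on the reversed carrier, which it
re-derives as `Torus.memLp_top_stLift_reversed`).  Hence BOTH stub texts hold outright: `cellEnergyT_uniform` (v21 text, uniform clauses
`CellEnergyClausesNoE`, C = 36k²Λ²/(π⁴lo²c), ν₀ = 1, K = 2) and `cellEnergyT_windowLocal` (registry-v2 text, `CellEnergyClausesWNoE`). -/

/-- D1 discharged: the duality pairing is a.e. constant (p640160). [cite: Temam1984, Ch. III §1 Lemma 1.2] -/
theorem pairingConst : PairingConst := by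
  intro T 𝔹 lo hi h𝔹 hlo b hb F u hF2 hFdiv hu t₀ ht₀ φ ψ hφ2 hφdiv _hbrev hψ
  have e : revCarrier b t₀ = fun r => -b (t₀ - r) := by
    funext r x
    simp [revCarrier]
  rw [e] at hψ
  exact hu.exists_ae_integral_inner_reversed_eq_const ht₀.1 ht₀.2 hψ h𝔹 hlo hF2 hFdiv hφ2 hφdiv hb

/-- **Clause (F) UNIFORM IN `T` + clause (C): the v21 `stub_cellEnergyT` text, unconditionally** (`C = 36k²Λ²/(π⁴lo²c)`, `ν₀ = 1`, `K = 2`).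
[this sketch] -/
theorem cellEnergyT_uniform :
    ∀ k (W : Literature.Analysis.FluidPDE.LatticeShear.LatticeWord k) (M : ℝ) (hM : 0 < M) (c : ℝ), 0 < c →
    ∀ lo hi Λ β : ℝ, 0 < lo → lo ≤ 1 → 1 ≤ hi → 1 < Λ → 0 ≤ β →
      ∃ C : ℝ, 0 ≤ C ∧ ∃ ν₀ > (0:ℝ), ∃ K > (0:ℝ), CellEnergyClausesNoE W M hM c lo hi Λ β C ν₀ K :=
  cellEnergyT_of_D1 pairingConst

/-- **The registry-v2 `stub_cellEnergyT` text (window-local clauses), unconditionally** — second, independent proof of the stub closed by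
the lead's primal `cellEnergyT_W` (p640158). [this sketch] -/
theorem cellEnergyT_windowLocal :
    ∀ k (W : Literature.Analysis.FluidPDE.LatticeShear.LatticeWord k) (M : ℝ) (hM : 0 < M) (c : ℝ), 0 < c →
    ∀ lo hi Λ β : ℝ, 0 < lo → lo ≤ 1 → 1 ≤ hi → 1 < Λ → 0 ≤ β →
      ∃ C : ℝ, 0 ≤ C ∧ ∃ ν₀ > (0:ℝ), ∃ K > (0:ℝ), CellEnergyClausesWNoE W M hM c lo hi Λ β C ν₀ K :=
  cellEnergyT_W_of_D1 pairingConst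

end Summit.AnomalousDissipation.AnomalousDissipation.Cruxes.LagrangianRenormalisationStep.DualLeakage

end
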